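import Literature.MathematicalPhysics.QuantumFieldTheory.Balaban1983to89.B3Ineq210MixedRegularRegion
import Literature.MathematicalPhysics.QuantumFieldTheory.Balaban1983to89.B1Ineq226RegularRegionSum
import Literature.MathematicalPhysics.QuantumFieldTheory.Balaban1983to89.B1Ineq238RegularRegion

/-!
# Bałaban, *(Higgs)₂,₃ quantum fields in a finite volume III. Renormalization* [B3] — (2.5) p. 424 with p. 414: THE KERNEL OF
`δG_k(Ω, Ω₂, B̃) = G_k(Ω, B̃) − G_k(Ω₂, B̃)`, TWICE DIFFERENTIATED (one covariant derivative in each variable), WITH THE PRINTED SMALLNESS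
`e^{−δ·dist(·, Ω₂ᶜ)}`, for NESTED BIG-BLOCK-UNION REGIONS `Ω₂ ⊆ Ω ⊆ T_ε` (incl. `Ω = T_ε`, EVERY `L ≥ 2`) AT A REGULAR NON-CONSTANT BACKGROUND
`B̃ = A`, AT INTERIOR POINTS OF `Ω₂` — PROVED piece by piece over the scale decomposition (2.6) (r14's region pieces `pieceR`)

statement-level skeleton of published theorems with citation tags; proofs where landed; nothing here is a claim about the Yang–Mills mass gap

T. Bałaban, Commun. Math. Phys. **88** (1983) 411–445 [cite: Balaban1983Higgs3]; inputs from part I, Commun. Math. Phys. **85** (1982)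
603–636 [cite: Balaban1982Higgs1] as landed in the tree.  PDF held: `paper:balaban1983-higgs-2-3-quantum-fields-finite-volume` (journal page =
PDF page + 410), p. 414 [PDF 4], p. 424 [PDF 14], p. 426 [PDF 16]; part I pp. 610–612 [PDF 8–10].

CITATION HEADER (lean-in-tree rule).  Cell `lit-balaban` (HOME `run/shared/lean/pub/lit-balaban/`), Phase-2 proof seat **p33** gen 58 (unit
`lit-balaban-p33`); SKELETON row **B3.Eq2.5** (fold owner r15; decl of record `B3Sect2Statements…Ineq25`, `typed p239134`; this file is a
LOCATED member — the twice-differentiated ENTRY of the two-variable kernel of `δG_k`, the input of the column move of the (1.32)-norm assembly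
of `hδG_kh′`; owner's division of labour 2026-08-22T22:50:53Z: r14 g18 `B3DeltaPiecesRegularNested` (p343577) = the per-piece VALUE clause,
p33 g59 `B3DeltaGkRegularRegion` = the kernel of `δG_k` (value and one-derivative entries) and the Hölder/assembly files, THIS file = the
mixed entry).  Companion of this seat's `B3Ineq210MixedRegularRegion` (p343340: the same mixed clause for `G^η_{(j)}(Ω,A)` itself, (2.10)).
USED BY NAME, never restated: r14's region pieces and engine `B3Ineq210RegularRegion` (`sandwichR`, `pieceR`, `levelSet`, `Interior`,
`towerR`, `mat_QG_eq_R`, `G_avgQkAdj_cb_eq_zero`, `mat_condCov232_levelSet`, `reg223R_of_small`, `propagatorK_apply_eq_chi`), r14's torus engine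
`B3Ineq210RegularTorus` (`sum3_le`, `exp_blockIter_le`, `norm_covDeriv_apply_le_sum_coord`, `blockDist_le_tdist`, `tdist_le_pow_mul_tdist_blockIter`),
p40's dipole algebra `B3Ineq210MixedRegularTorus` (`dip`, `onb`, `fieldCoord_dip_dotProduct`, `dip_support_dist`, `abs_fieldCoord_apply_le`),
p35's Proposition I.2.1 on big-block regions — (2.25) derivative member `B1Ineq225DerivRegularRegion.norm_covDeriv_propagatorK_region_reg_decay_sum`
and (2.26) derivative member `B1Ineq226RegularRegionSum.deltaG_region_reg_decay_sum` —, p35's one-parameter Proposition I.2.3 for regions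
`B1Prop23RegularRegionSmall.prop23_regular_region_small` ((2.34) and the conditioning correction (2.35)), r14's (2.38) for regions
`B1Ineq238RegularRegion.prop23_238_regular_region`, r14's `B1Ineq234Concrete.distC`, p35's `covDeriv_sub'`, the typer's `HiggsLattice`.

## What is printed (verbatim)

p. 414 [PDF 4]: *"δG_k(Ω, Ω₂, B̃) = G_k(Ω, B̃) − G_k(Ω₂, B̃) … The bound follows easily from the properties of the propagators G_k(Ω, A) proved
in the next paper."*  (2.5) p. 424 [PDF 14]: *"‖h δG_k(Ω, Ω₂, B̃) h′‖ ≤ O(1) e^{−δ₀ dist(Ω₂ᶜ, supp h ∪ supp h′)} e^{−δ₀ d(supp h, supp h′)}"*, the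
norm being the two-variable norm (1.32) p. 420 (values, covariant derivatives in both variables, Hölder quotients).  (2.6) p. 424:
`G_k(Ω,B̃) = Σ_{j=0}^{k−1} G^η_{(j)}(Ω,B̃)`; (2.10) p. 426: *"… and if the propagator is differentiated, then for each differentiation, there
is an additional factor (L^jη)^{−1} on the right side."*  Part I, (2.26) p. 610: *"If Ω ⊂ Ω₀, then for δG_k(Ω, Ω₀, A) … we have the
inequalities (2.24), (2.25) with the additional factor exp(−δ₀ dist(supp f, Ωᶜ) − δ₀ dist({x, x′}, Ωᶜ)) on the right sides"*; (2.38)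
p. 612: the same for the conditional covariances `C^{(k)}`.

## What this file proves (`deltaGk_mixed_regularRegion`), and how

For nested big-block unions `Ω₂ ⊆ Ω ⊆ T_ε` and the difference of r14's region pieces, `δG^η_{(j)} := G^η_{(j)}(Ω,A) − G^η_{(j)}(Ω₂,A)`
(so that `Σ_j δG^η_{(j)} = δG_k(Ω,Ω₂,A)`, r14's `sum_pieceR`), at INTERIOR points `x, x′` of `Ω₂` (`Interior k K₀ Ω₂`, r14's form of the
`R₀`-clause of Proposition I.2.1) and a `δ_A`-regular background on `Ω`:
`ε^{−d}ε^{−1}Σ_i‖(D^ε_{A,μ} δG^η_{(j)} dip_{⟨x′,ν⟩}e_i)(x)‖ ≤ C·(L^jε)^{−d}·exp(−δ₁(|x − x′| + dist(x,Ω₂ᶜ) + dist(x′,Ω₂ᶜ))/L^j)` (`mixedDeltaTermR`;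
p40's dipole `dip_c w = ε·D^{ε*}_A(δ_c w)` realises the right derivative), i.e. the twice-differentiated clause of (2.10) for `δG` WITH the
smallness of (2.5)/(I.2.26) in the distance of the two points from `Ω₂ᶜ`.  ROUTE (the print's "follows easily from the properties of the
propagators", through (2.6)): §2 the difference of the terms of (I.2.43) telescopes,
`δ(G_jQ_j^*C_jQ_jG_j) = δG_j·Q_j^*C_j(Ω)Q_j·G_j(Ω) + G_j(Ω₂)·Q_j^*C_j(Ω)Q_j·δG_j + G_j(Ω₂)·Q_j^*δC_j·Q_j·G_j(Ω₂)` (`sandwichR_sub_eq`; r14's p343577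
has the same telescoping for the value clause); §1 a GENERIC five-factor engine `‖(D^ε_A F₁Q^*MQF₃ dip_c w)(b)‖ ≤ L^{−ld}ε‖w‖ΣΣ‖D_bF₁Q^*e_s‖·|M(s,t)|·
‖D_cF₃′Q^*e_t‖` for any `F₃′` adjoint to `F₃` across `Q` (both `G^ε_l(Ω)` and `δG` qualify: `mat_QG_eq_R`, `mat_Q_deltaG_eq`), below the triple
convolution `sum3_le` with a growth allowance `σ` for the middle kernel; §3 the three telescoped terms at bonds of `Ω₂`: `δG_j` at `b` and at
`c` by (I.2.26), derivative member (smallness `e^{−dist(·,Ω₂ᶜ)/(8K₀L^j)}` folded into the constants), `G_j(Ω)`, `G_j(Ω₂)` by (I.2.25), `C_j(Ω)`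
by (I.2.34) on `Ω^{(j)}`, `δC_j = [C^{(j)}(Ω) − C^{(j)}_{Ω₂^{(j)}}(Ω)] + [C^{(j)}_{Ω₂^{(j)}}(Ω) − C^{(j)}(Ω₂)]` on `Ω₂^{(j)} × Ω₂^{(j)}` by (I.2.35)
(p35's second member) and (I.2.38) (r14), whose factor `e^{−δ(dist(y_s,Ω₂^{(j)c}) + dist(y_t,Ω₂^{(j)c}))}` is moved to the end-points by the
triangle inequality at the cost of half the rate (`exp_distC_le_of_triangle`) and down to the fine lattice (`exp_distC_block_le`:
`dist(x,Ω₂ᶜ) ≤ L^j(dist(x_j,Ω₂^{(j)c}) + 1)` for a union of `j`-blocks); sources in blocks outside a region do not reach its bonds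
(`covDeriv_G_avgQkAdj_cb_eq_zero_R` of the companion file, `covDeriv_deltaG_cb_eq_zero`); §4 the pieces (`j = 0`: (I.2.26) at level `1` on the dipole; `1 ≤ j < k`: the
scaling `a_j²(L^jε)^{−4}(L^jε)^{1+2+1}L^{−jd}ε·ε^{−d}ε^{−1} = a_j²(L^jε)^{−d}`; `j ≥ k`: no term); §5 the constants, and the squeeze
`e^{−δ dist(x,Ω₂ᶜ)}e^{−δ|x−x′|} ≤ e^{−(δ/2)(|x−x′| + dist(x,Ω₂ᶜ) + dist(x′,Ω₂ᶜ))}` (`dist(x′,Ω₂ᶜ) ≤ |x−x′| + dist(x,Ω₂ᶜ)`, `exp_squeeze`).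

## Honest scope

Interior points of `Ω₂` only (nothing within the margin `2r_S + 2L^kK₀(d+1) + 1` of `Ω₂ᶜ`); `m² > 0`; `Ω₂ ⊆ Ω` unions of `L^kK₀`-cells in a
volume with `K₀ ∣ M` and at least three cubes a side, `L^kε ≤ 1`; the regularity hypothesis in BOTH printed currencies — `L^k·δ_A·|e| ≤ t`
AND `L^k·δ_A ≤ c|e|` with `e² ≤ E₀(c)` — because the (I.2.38) input is landed in the second currency (r14's v1.1 shape of the (2.10) region
member); constants after the charge data and depending on `K₀`; distances `dist(·,Ω₂ᶜ) = distC Ω₂` in lattice units of `T_ε` (`= 0` for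
`Ω₂ = T_ε`, where the statement reduces to the plain mixed clause); `|·|` of a block = column sum of Euclidean norms over an orthonormal basis.
NOT in this file: the value and one-derivative entries (p33 g59 / r14 p343577), the Hölder quotients, the (1.32)-norm assembly of `hδG_kh′`
with transports, (1.16).  No `def … : Prop`, no new named fact (`mixedDeltaTermR` is a concrete `def`); axioms standard.  Value = kernel
certificate of one located entry of a by-reference step of B3 at a regular background on regions, NOT summit progress.

v1.1 (p33 gen 66, 2026-08-23; DOC-ONLY, declarations byte-identical): citation locator of `covDeriv_add'` corrected from «(1.6) p.605»
to «(1.7) p.605» — in part I, (1.6) p. 604 is the plaquette derivative `ε⁻¹Σ_{b⊂∂P}A_b = (∂^ε_μA_ν)(x) − (∂^ε_νA_μ)(x)` and (1.7) p. 605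
is the covariant derivative `(D^ε_Aφ)(b) = ε⁻¹(U(A_b)φ(b₊) − φ(b₋))` (text layer of [cite: Balaban1982Higgs1] re-read; CITELOC note
P86-001 of the cell's citation pass).
-/

noncomputable section

open scoped BigOperators InnerProductSpace Matrix

namespace Literature.MathematicalPhysics.QuantumFieldTheory.Balaban1983to89.B3DeltaGkMixedRegularRegion

open HiggsLattice (ChargeData ScalarField siteInner covDeriv)
open HiggsCovariance (propagatorK avgQkLin avgQkAdj E)
open HiggsAveraging (blockIter)
open HiggsFluctMeasure (coeff221)
open HiggsFluctMeasurePos (blockIter_surjective)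
open B1Eq221Coordinates (fieldCoord fieldCoord_apply siteCoord_apply sum_inner_eq_dotProduct)
open B1Eq230FluctCov (mat Ix cb fluctCovA cb_repr mat_mulVec adjoint_transfer)
open HiggsCondCov232 (condCov232)
open B1Eq230FluctCovPos (siteInner_propagatorK_comm)
open B1Ineq234Concrete (profile profile_nonneg' nCol fieldCoord_cb distC distC_nonneg distC_le distC_univ)
open B1Ineq234LevelZero (tdist_comm tdist_triangle_real tdist_shift_le_one)
open B1TorusCubeCover (half)
open B1TorusCubeLocality26 (rS)
open B1TorusRegionRop (chi)
open B1TorusRegionHSizes (IsBigBlockUnion isBigBlockUnion_univ)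
open B2Eq337ScalarIntegration (Regions)
open B2Eq328ConcretePieces (pieceF)
open B1Ineq226RegularRegion (covDeriv_sub')
open B3Ineq210RegularTorus (norm_avgQkAdj_cb_le blockIter_eq_of_avgQkAdj_cb_ne_zero blockDist_le_tdist sum3_le exp_blockIter_le
  norm_apply_le_sum_coord norm_covDeriv_apply_le_sum_coord abs_mat_le_norm norm_cb_le mesh_eq_pow_mul card_Ix eq_of_cb_ne_zero
  aSeq_sq_le covDeriv_smul'' covDeriv_zero'' mesh_mono tdist_le_pow_mul_tdist_blockIter)
open B3Ineq210RegularRegion (levelSet sandwichR pieceR pieceR_zero pieceR_of_pos pieceR_of_le Interior G_avgQkAdj_cb_eq_zero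
  norm_covDeriv_G_avgQkAdj_cb_le_R mat_QG_eq_R siteInner_QG_adjoint_R blockUnion_of_isBigBlockUnion isBigBlockUnion_of_le reg223R_of_small
  half_mono propagatorK_apply_eq_chi towerR pieceF_towerR levelSet_blockUnion mat_condCov232_levelSet interior_univ)
open B3Ineq210MixedRegularTorus (onb norm_onb dip norm_dip_le dip_eq_zero_of_ne sum_inner_dip fieldCoord_dip_dotProduct siteInner_dip
  norm_covDeriv_dip_le_sum dip_support_dist abs_fieldCoord_apply_le siteInner_single_right)
open B3Ineq210MixedRegularRegion (covDeriv_G_avgQkAdj_cb_eq_zero_R)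

variable {P : HiggsLattice.Params} {N : ℕ}

/-! ## §0 Tools: interior points and level sets of nested regions, distances to the complement, differences of operators -/

section ToolsR

variable {k K₀ : ℕ} {Ω Ω₂ : Finset (HiggsLattice.Site P 0)}

/-- An interior point of `Ω₂ ⊆ Ω` is an interior point of `Ω`. [cite: Balaban1982Higgs1, Prop. 2.1 p.610] -/
theorem Interior.mono (h : Ω₂ ⊆ Ω) {x : HiggsLattice.Site P 0} (hx : Interior k K₀ Ω₂ x) : Interior k K₀ Ω x :=
  fun y hy => h (hx y hy)

/-- `Ω₂ ⊆ Ω ⇒ Ω₂^{(l)} ⊆ Ω^{(l)}`. [cite: Balaban1982Higgs1, (2.20) p.610] -/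
theorem levelSet_mono {l : ℕ} (h : Ω₂ ⊆ Ω) : (levelSet l Ω₂ : Finset (HiggsLattice.Site P l)) ⊆ levelSet l Ω :=
  Finset.image_subset_image h

/-- **Triangle inequality for the distance to the complement**: `dist(y, Λᶜ) ≤ |y − y′| + dist(y′, Λᶜ)`.
[cite: Balaban1982Higgs1, (2.36) p.612] -/
theorem distC_le_tdist_add {l : ℕ} (Λ : Finset (HiggsLattice.Site P l)) (y y' : HiggsLattice.Site P l) :
    distC Λ y ≤ (HiggsLattice.Site.tdist y y' : ℝ) + distC Λ y' := by
  by_cases h : (Λᶜ).Nonempty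
  · obtain ⟨z, hz, hmin⟩ := Finset.exists_mem_eq_inf' h (fun w => (HiggsLattice.Site.tdist y' w : ℝ))
    have hz' : z ∉ Λ := Finset.mem_compl.mp hz
    have h1 : distC Λ y' = (HiggsLattice.Site.tdist y' z : ℝ) := by
      unfold distC; rw [dif_pos h, hmin]
    rw [h1]
    exact (distC_le Λ y hz').trans (tdist_triangle_real y y' z)
  · have h0 : distC Λ y = 0 := by unfold distC; rw [dif_neg h]
    rw [h0]
    exact add_nonneg (Nat.cast_nonneg _) (distC_nonneg Λ y')

/-- **From the fine lattice to the blocks**: for a union `Ω₂` of `L^l`-blocks, `dist(x, Ω₂ᶜ) ≤ L^l·(dist(x_l, (Ω₂^{(l)})ᶜ) + 1)` — a block outside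
`Ω₂^{(l)}` consists of points outside `Ω₂`, at most `L^l|x_l − y| + L^l − 1` away. [cite: Balaban1982Higgs1, (1.20) p.607, (2.36) p.612] -/
theorem distC_le_pow_mul {l : ℕ} (hl : l ≤ P.K)
    (hΩ₂ : ∀ x x' : HiggsLattice.Site P 0, blockIter l x = blockIter l x' → (x ∈ Ω₂ ↔ x' ∈ Ω₂)) (x : HiggsLattice.Site P 0) :
    distC Ω₂ x ≤ (P.L : ℝ) ^ l * (distC (levelSet l Ω₂) (blockIter l x) + 1) := by
  have hLl : (0 : ℝ) < (P.L : ℝ) ^ l := pow_pos (by exact_mod_cast P.hL) l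
  by_cases h : ((levelSet l Ω₂)ᶜ).Nonempty
  · obtain ⟨y, hy, hmin⟩ := Finset.exists_mem_eq_inf' h (fun w => (HiggsLattice.Site.tdist (blockIter l x) w : ℝ))
    have hy' : y ∉ levelSet l Ω₂ := Finset.mem_compl.mp hy
    have h1 : distC (levelSet l Ω₂) (blockIter l x) = (HiggsLattice.Site.tdist (blockIter l x) y : ℝ) := by
      unfold distC; rw [dif_pos h, hmin]
    obtain ⟨z, hz⟩ := blockIter_surjective hl y
    have hzΩ : z ∉ Ω₂ := by
      intro hzΩ
      exact hy' (Finset.mem_image.mpr ⟨z, hzΩ, hz⟩)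
    have h2 := distC_le Ω₂ x hzΩ
    have h3 := tdist_le_pow_mul_tdist_blockIter hl x z
    rw [hz] at h3
    have h3' : (HiggsLattice.Site.tdist x z : ℝ) ≤ (P.L : ℝ) ^ l * (HiggsLattice.Site.tdist (blockIter l x) y : ℝ) + ((P.L : ℝ) ^ l - 1) := by
      have h1le : 1 ≤ P.L ^ l := Nat.one_le_pow _ _ (by have := P.hL; omega)
      have := (Nat.cast_le (α := ℝ)).mpr h3
      rw [Nat.cast_add, Nat.cast_mul, Nat.cast_pow, Nat.cast_sub h1le, Nat.cast_pow, Nat.cast_one] at this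
      exact this
    rw [h1]
    nlinarith
  · have h0 : distC (levelSet l Ω₂) (blockIter l x) = 0 := by unfold distC; rw [dif_neg h]
    -- every block lies in `Ω₂^{(l)}`, hence `Ω₂ = T_ε` and `dist(x, Ω₂ᶜ) = 0`
    have hall : ∀ z : HiggsLattice.Site P 0, z ∈ Ω₂ := by
      intro z
      have hmem : blockIter l z ∈ levelSet l Ω₂ := by
        by_contra hne
        exact h ⟨blockIter l z, Finset.mem_compl.mpr hne⟩
      obtain ⟨z', hz', hzz'⟩ := Finset.mem_image.mp hmem
      exact (hΩ₂ z' z hzz').mp hz'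
    have hx0 : distC Ω₂ x = 0 := by
      unfold distC
      rw [dif_neg]
      rintro ⟨z, hz⟩
      exact (Finset.mem_compl.mp hz) (hall z)
    rw [h0, hx0]
    positivity

/-- **Exponential form**: `e^{−σ·dist(x_l,(Ω₂^{(l)})ᶜ)} ≤ e^{σ}·e^{−σ·dist(x,Ω₂ᶜ)/L^l}` (`σ ≥ 0`). [cite: Balaban1982Higgs1, (1.20) p.607, (2.36) p.612] -/
theorem exp_distC_block_le {l : ℕ} (hl : l ≤ P.K)
    (hΩ₂ : ∀ x x' : HiggsLattice.Site P 0, blockIter l x = blockIter l x' → (x ∈ Ω₂ ↔ x' ∈ Ω₂)) {σ : ℝ} (hσ : 0 ≤ σ)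
    (x : HiggsLattice.Site P 0) :
    Real.exp (-(σ * distC (levelSet l Ω₂) (blockIter l x))) ≤ Real.exp σ * Real.exp (-(σ * (distC Ω₂ x / (P.L : ℝ) ^ l))) := by
  rw [← Real.exp_add]
  apply Real.exp_le_exp.mpr
  have hLl : (0 : ℝ) < (P.L : ℝ) ^ l := pow_pos (by exact_mod_cast P.hL) l
  have h := distC_le_pow_mul hl hΩ₂ x
  have h' : distC Ω₂ x / (P.L : ℝ) ^ l ≤ distC (levelSet l Ω₂) (blockIter l x) + 1 := by
    rw [div_le_iff₀ hLl]; linarith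
  nlinarith

/-- **Exponential form of the block triangle inequality**: `e^{−σ·dist(y,Λᶜ)} ≤ e^{σ|y′−y|}·e^{−σ·dist(y′,Λᶜ)}` (`σ ≥ 0`).
[cite: Balaban1982Higgs1, (2.36) p.612] -/
theorem exp_distC_le_of_triangle {l : ℕ} (Λ : Finset (HiggsLattice.Site P l)) {σ : ℝ} (hσ : 0 ≤ σ) (y y' : HiggsLattice.Site P l) :
    Real.exp (-(σ * distC Λ y)) ≤ Real.exp (σ * (HiggsLattice.Site.tdist y' y : ℝ)) * Real.exp (-(σ * distC Λ y')) := by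
  rw [← Real.exp_add]
  apply Real.exp_le_exp.mpr
  have h := distC_le_tdist_add Λ y' y
  nlinarith

variable (C : ChargeData N) (A : HiggsLattice.VecField P 0) {l : ℕ}

/-- Entries of a difference of operators. [cite: Balaban1982Higgs1, (2.26) p.610] -/
theorem mat_sub {i j : ℕ} (X Y : ScalarField P i N →ₗ[ℝ] ScalarField P j N) (s : HiggsLattice.Site P j × Ix N)
    (t : HiggsLattice.Site P i × Ix N) : mat (X - Y) s t = mat X s t - mat Y s t := by
  simp only [B2Eq246ScalarStep.mat_apply, LinearMap.sub_apply, map_sub, Pi.sub_apply]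

/-- **Adjointness of `Q_l·δG` and `δG·Q_l^*`** for a difference of two region propagators: `(Q_l δG)(t,q) = L^{−ld}(δG Q_l^*)(q,t)`
(r14's `mat_QG_eq_R` for each region). [cite: Balaban1982Higgs1, (1.5) p.604, (2.20), (2.26) p.610] -/
theorem mat_Q_deltaG_eq (Ω Ω₂ : Finset (HiggsLattice.Site P 0)) (msq a : ℝ) (t : HiggsLattice.Site P l × Ix N)
    (q : HiggsLattice.Site P 0 × Ix N) :
    mat (avgQkLin C A l ∘ₗ (propagatorK C Ω A msq a l - propagatorK C Ω₂ A msq a l)) t q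
      = (((P.L : ℝ) ^ l) ^ P.d)⁻¹ * mat ((propagatorK C Ω A msq a l - propagatorK C Ω₂ A msq a l) ∘ₗ avgQkAdj C A l) q t := by
  rw [LinearMap.comp_sub, LinearMap.sub_comp, mat_sub, mat_sub, mat_QG_eq_R, mat_QG_eq_R, mul_sub]

end ToolsR

/-! ## §1 The generic engine: a five-factor product `F₁Q_l^*·M·Q_lF₃` on a dipole source, differentiated, below a triple kernel sum -/

section EngineG

variable (C : ChargeData N) (A : HiggsLattice.VecField P 0) {l : ℕ}

/-- **The third kernel on a dipole source by adjointness, generic**: if `(Q_lF₃)(t,q) = L^{−ld}(F₃′Q_l^*)(q,t)` then the coordinates of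
`Q_lF₃(dip_c w)` are bounded by `L^{−ld}·ε·‖w‖·‖(D^ε_A F₃′Q_l^*e_t)(c)‖` (p40's dipole identity `fieldCoord_dip_dotProduct`).
[cite: Balaban1982Higgs1, (1.5) p.604, (2.20) p.610] -/
theorem abs_coord_QF_dip_le (F₃ F₃' : ScalarField P 0 N →ₗ[ℝ] ScalarField P 0 N)
    (hadj : ∀ (t : HiggsLattice.Site P l × Ix N) (q : HiggsLattice.Site P 0 × Ix N),
      mat (avgQkLin C A l ∘ₗ F₃) t q = (((P.L : ℝ) ^ l) ^ P.d)⁻¹ * mat (F₃' ∘ₗ avgQkAdj C A l) q t)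
    (c : HiggsLattice.PBond P 0) (w : E N) (t : HiggsLattice.Site P l × Ix N) :
    |fieldCoord (E N) (HiggsLattice.Site P l) (avgQkLin C A l (F₃ (dip C A c w))) t|
      ≤ (((P.L : ℝ) ^ l) ^ P.d)⁻¹ * (P.mesh 0 * (‖w‖ * ‖covDeriv C A (F₃' (avgQkAdj C A l (cb P N l t))) c‖)) := by
  set X := avgQkLin C A l ∘ₗ F₃ with hX
  set Xs := F₃' ∘ₗ avgQkAdj C A l with hXs
  have hL : (0 : ℝ) ≤ (((P.L : ℝ) ^ l) ^ P.d)⁻¹ := inv_nonneg.mpr (pow_nonneg (pow_nonneg (Nat.cast_nonneg _) l) _)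
  have h1 : fieldCoord (E N) (HiggsLattice.Site P l) (avgQkLin C A l (F₃ (dip C A c w))) t
      = ∑ q : HiggsLattice.Site P 0 × Ix N, mat X t q * fieldCoord (E N) (HiggsLattice.Site P 0) (dip C A c w) q := by
    have : avgQkLin C A l (F₃ (dip C A c w)) = X (dip C A c w) := rfl
    rw [this, ← mat_mulVec]; rfl
  have h2 : ∑ q : HiggsLattice.Site P 0 × Ix N, mat X t q * fieldCoord (E N) (HiggsLattice.Site P 0) (dip C A c w) q
      = (((P.L : ℝ) ^ l) ^ P.d)⁻¹ *
        (fieldCoord (E N) (HiggsLattice.Site P 0) (dip C A c w) ⬝ᵥ fieldCoord (E N) (HiggsLattice.Site P 0) (Xs (cb P N l t))) := by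
    rw [dotProduct, Finset.mul_sum]
    refine Finset.sum_congr rfl fun q _ => ?_
    rw [hadj, B2Eq246ScalarStep.mat_apply]
    ring
  rw [h1, h2, fieldCoord_dip_dotProduct, abs_mul, abs_of_nonneg hL]
  refine mul_le_mul_of_nonneg_left ?_ hL
  rw [abs_mul, abs_of_nonneg (P.mesh_pos 0).le]
  refine mul_le_mul_of_nonneg_left ?_ (P.mesh_pos 0).le
  rw [hXs, LinearMap.comp_apply]
  exact (abs_real_inner_le_norm _ _)

/-- **THE GENERIC ENGINE (algebraic part)**: for linear maps `F₁, F₃` on `ε`-fields, `M` on `L^lε`-fields, and `F₃′` adjoint to `F₃` across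
`Q_l` as above, `‖(D^ε_A F₁Q_l^*MQ_lF₃ dip_c w)(b)‖ ≤ L^{−ld}·ε‖w‖·Σ_sΣ_t ‖(D^ε_AF₁Q_l^*e_s)(b)‖·|M(s,t)|·‖(D^ε_AF₃′Q_l^*e_t)(c)‖` — the
expansion of the field in the block basis (r14's `norm_covDeriv_apply_le_sum_coord`), the matrix of `M`, and the adjointness on the right.
[cite: Balaban1982Higgs1, (2.43) p.612, (2.20) p.610] -/
theorem norm_covDeriv_comp5_dip_le (F₁ F₃ F₃' : ScalarField P 0 N →ₗ[ℝ] ScalarField P 0 N)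
    (M : ScalarField P l N →ₗ[ℝ] ScalarField P l N)
    (hadj : ∀ (t : HiggsLattice.Site P l × Ix N) (q : HiggsLattice.Site P 0 × Ix N),
      mat (avgQkLin C A l ∘ₗ F₃) t q = (((P.L : ℝ) ^ l) ^ P.d)⁻¹ * mat (F₃' ∘ₗ avgQkAdj C A l) q t)
    (c : HiggsLattice.PBond P 0) (w : E N) (b : HiggsLattice.PBond P 0) :
    ‖covDeriv C A ((F₁ ∘ₗ avgQkAdj C A l ∘ₗ M ∘ₗ avgQkLin C A l ∘ₗ F₃) (dip C A c w)) b‖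
      ≤ (((P.L : ℝ) ^ l) ^ P.d)⁻¹ * (P.mesh 0 * ‖w‖) *
        ∑ s : HiggsLattice.Site P l × Ix N, ∑ t : HiggsLattice.Site P l × Ix N,
          ‖covDeriv C A (F₁ (avgQkAdj C A l (cb P N l s))) b‖ * |mat M s t| *
            ‖covDeriv C A (F₃' (avgQkAdj C A l (cb P N l t))) c‖ := by
  have h0 : (F₁ ∘ₗ avgQkAdj C A l ∘ₗ M ∘ₗ avgQkLin C A l ∘ₗ F₃) (dip C A c w)
      = (F₁ ∘ₗ avgQkAdj C A l) (M (avgQkLin C A l (F₃ (dip C A c w)))) := by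
    simp only [LinearMap.comp_apply]
  rw [h0]
  refine (norm_covDeriv_apply_le_sum_coord C A _ _ b).trans ?_
  have hL : (0 : ℝ) ≤ (((P.L : ℝ) ^ l) ^ P.d)⁻¹ := inv_nonneg.mpr (pow_nonneg (pow_nonneg (Nat.cast_nonneg _) l) _)
  have hεw : 0 ≤ P.mesh 0 * ‖w‖ := mul_nonneg (P.mesh_pos 0).le (norm_nonneg _)
  rw [Finset.mul_sum]
  refine Finset.sum_le_sum fun s _ => ?_
  have h1 : |fieldCoord (E N) (HiggsLattice.Site P l) (M (avgQkLin C A l (F₃ (dip C A c w)))) s|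
      ≤ ∑ t : HiggsLattice.Site P l × Ix N, |mat M s t| *
          ((((P.L : ℝ) ^ l) ^ P.d)⁻¹ * (P.mesh 0 * (‖w‖ * ‖covDeriv C A (F₃' (avgQkAdj C A l (cb P N l t))) c‖))) :=
    (abs_fieldCoord_apply_le M _ s).trans (Finset.sum_le_sum fun t _ =>
      mul_le_mul_of_nonneg_left (abs_coord_QF_dip_le C A F₃ F₃' hadj c w t) (abs_nonneg _))
  have h2 : 0 ≤ ‖covDeriv C A ((F₁ ∘ₗ avgQkAdj C A l) (cb P N l s)) b‖ := norm_nonneg _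
  calc |fieldCoord (E N) (HiggsLattice.Site P l) (M (avgQkLin C A l (F₃ (dip C A c w)))) s| *
        ‖covDeriv C A ((F₁ ∘ₗ avgQkAdj C A l) (cb P N l s)) b‖
      ≤ (∑ t : HiggsLattice.Site P l × Ix N, |mat M s t| *
          ((((P.L : ℝ) ^ l) ^ P.d)⁻¹ * (P.mesh 0 * (‖w‖ * ‖covDeriv C A (F₃' (avgQkAdj C A l (cb P N l t))) c‖)))) *
        ‖covDeriv C A ((F₁ ∘ₗ avgQkAdj C A l) (cb P N l s)) b‖ := mul_le_mul_of_nonneg_right h1 h2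
    _ = _ := by
        rw [LinearMap.comp_apply, Finset.mul_sum, Finset.sum_mul]
        refine Finset.sum_congr rfl fun t _ => ?_
        ring

/-- **THE GENERIC ENGINE (analytic part)**: if the summand is termwise below `Θ·e^{−ρ|b_l−y_s|}e^{−ρ|y_s−y_t|}e^{−ρ|c_l−y_t|}` (`ρ > 0`), the
double sum is `≤ Θ·K(ρ/2)²·e^{ρ/2}·e^{−(ρ/2)|b−c|/L^l}` (r14's `sum3_le`, `exp_blockIter_le`). [cite: Balaban1982Higgs1, (2.43) p.612] -/
theorem sum_prod3_le (hl : l ≤ P.K) {ρ Θ : ℝ} (hρ : 0 < ρ) (hΘ : 0 ≤ Θ) (b c : HiggsLattice.PBond P 0)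
    (f : (HiggsLattice.Site P l × Ix N) → (HiggsLattice.Site P l × Ix N) → ℝ)
    (hf : ∀ s t, f s t ≤ Θ * (Real.exp (-(ρ * (HiggsLattice.Site.tdist (blockIter l b.src) s.1 : ℝ))) *
      Real.exp (-(ρ * (HiggsLattice.Site.tdist s.1 t.1 : ℝ))) * Real.exp (-(ρ * (HiggsLattice.Site.tdist (blockIter l c.src) t.1 : ℝ))))) :
    ∑ s : HiggsLattice.Site P l × Ix N, ∑ t : HiggsLattice.Site P l × Ix N, f s t
      ≤ Θ * (profile P N (ρ / 2) ^ 2 * Real.exp (ρ / 2)) *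
          Real.exp (-(ρ / 2 * ((HiggsLattice.Site.tdist b.src c.src : ℝ) / (P.L : ℝ) ^ l))) := by
  rcases isEmpty_or_nonempty (Ix N) with hN | ⟨⟨i₀⟩⟩
  · rw [Finset.univ_eq_empty, Finset.sum_empty]
    have hK : 0 ≤ profile P N (ρ / 2) := profile_nonneg' _ (by linarith)
    positivity
  calc ∑ s : HiggsLattice.Site P l × Ix N, ∑ t : HiggsLattice.Site P l × Ix N, f s t
      ≤ ∑ s : HiggsLattice.Site P l × Ix N, ∑ t : HiggsLattice.Site P l × Ix N,
          Θ * (Real.exp (-(ρ * (HiggsLattice.Site.tdist (blockIter l b.src) s.1 : ℝ))) *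
            Real.exp (-(ρ * (HiggsLattice.Site.tdist s.1 t.1 : ℝ))) *
            Real.exp (-(ρ * (HiggsLattice.Site.tdist (blockIter l c.src) t.1 : ℝ)))) :=
        Finset.sum_le_sum fun s _ => Finset.sum_le_sum fun t _ => hf s t
    _ = Θ * ∑ s : HiggsLattice.Site P l × Ix N, ∑ t : HiggsLattice.Site P l × Ix N,
          Real.exp (-(ρ * (HiggsLattice.Site.tdist (blockIter l b.src) s.1 : ℝ))) *
            Real.exp (-(ρ * (HiggsLattice.Site.tdist s.1 t.1 : ℝ))) *
            Real.exp (-(ρ * (HiggsLattice.Site.tdist (blockIter l c.src) t.1 : ℝ))) := by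
        rw [Finset.mul_sum]
        refine Finset.sum_congr rfl fun s _ => ?_
        rw [Finset.mul_sum]
    _ ≤ Θ * (profile P N (ρ / 2) ^ 2 *
          Real.exp (-(ρ / 2 * (HiggsLattice.Site.tdist (blockIter l b.src) (blockIter l c.src) : ℝ)))) :=
        mul_le_mul_of_nonneg_left (sum3_le hρ (blockIter l b.src) (blockIter l c.src) i₀) hΘ
    _ ≤ Θ * (profile P N (ρ / 2) ^ 2 * (Real.exp (ρ / 2) *
          Real.exp (-(ρ / 2 * ((HiggsLattice.Site.tdist b.src c.src : ℝ) / (P.L : ℝ) ^ l))))) := by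
        have hK : 0 ≤ profile P N (ρ / 2) := profile_nonneg' _ (by linarith)
        exact mul_le_mul_of_nonneg_left (mul_le_mul_of_nonneg_left (exp_blockIter_le hl (by linarith) b.src c.src)
          (pow_nonneg hK 2)) hΘ
    _ = _ := by ring

/-- **THE GENERIC ENGINE (with kernel bounds)**: if the left kernel vanishes for `y_s ∉ S` and is `≤ α₁e^{−ρ|b_l−y_s|}` on `S`, the right kernel
vanishes for `y_t ∉ T` and is `≤ α₃e^{−ρ|c_l−y_t|}` on `T`, and the middle matrix is `≤ βe^{−ρ|y_s−y_t|}·e^{σ|b_l−y_s|}e^{σ|c_l−y_t|}` on `S × T`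
(a growth allowance `2σ ≤ ρ`, used by the `δC` term), then `‖(D^ε_AF₁Q_l^*MQ_lF₃ dip_c w)(b)‖ ≤
α₁βα₃·L^{−ld}·ε‖w‖·K((ρ−σ)/2)²e^{(ρ−σ)/2}·e^{−((ρ−σ)/2)|b−c|/L^l}`. [cite: Balaban1982Higgs1, (2.43) p.612, Prop. 2.1 (2.25) p.610, Prop. 2.3 (2.34) p.611] -/
theorem norm_covDeriv_comp5_dip_le_of_kernels (hl : l ≤ P.K) (F₁ F₃ F₃' : ScalarField P 0 N →ₗ[ℝ] ScalarField P 0 N)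
    (M : ScalarField P l N →ₗ[ℝ] ScalarField P l N)
    (hadj : ∀ (t : HiggsLattice.Site P l × Ix N) (q : HiggsLattice.Site P 0 × Ix N),
      mat (avgQkLin C A l ∘ₗ F₃) t q = (((P.L : ℝ) ^ l) ^ P.d)⁻¹ * mat (F₃' ∘ₗ avgQkAdj C A l) q t)
    (S T : Finset (HiggsLattice.Site P l)) {b c : HiggsLattice.PBond P 0} (w : E N) {α₁ α₃ β ρ σ : ℝ}
    (hα₁ : 0 ≤ α₁) (hα₃ : 0 ≤ α₃) (hβ : 0 ≤ β) (hρ : 0 < ρ) (hσ : 0 ≤ σ) (hσρ : 2 * σ ≤ ρ)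
    (hS : ∀ s : HiggsLattice.Site P l × Ix N, s.1 ∉ S → covDeriv C A (F₁ (avgQkAdj C A l (cb P N l s))) b = 0)
    (hT : ∀ t : HiggsLattice.Site P l × Ix N, t.1 ∉ T → covDeriv C A (F₃' (avgQkAdj C A l (cb P N l t))) c = 0)
    (h1 : ∀ s : HiggsLattice.Site P l × Ix N, s.1 ∈ S →
      ‖covDeriv C A (F₁ (avgQkAdj C A l (cb P N l s))) b‖
        ≤ α₁ * Real.exp (-(ρ * (HiggsLattice.Site.tdist (blockIter l b.src) s.1 : ℝ))))
    (h3 : ∀ t : HiggsLattice.Site P l × Ix N, t.1 ∈ T →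
      ‖covDeriv C A (F₃' (avgQkAdj C A l (cb P N l t))) c‖
        ≤ α₃ * Real.exp (-(ρ * (HiggsLattice.Site.tdist (blockIter l c.src) t.1 : ℝ))))
    (hM : ∀ s t : HiggsLattice.Site P l × Ix N, s.1 ∈ S → t.1 ∈ T →
      |mat M s t| ≤ β * Real.exp (-(ρ * (HiggsLattice.Site.tdist s.1 t.1 : ℝ))) *
        (Real.exp (σ * (HiggsLattice.Site.tdist (blockIter l b.src) s.1 : ℝ)) *
          Real.exp (σ * (HiggsLattice.Site.tdist (blockIter l c.src) t.1 : ℝ)))) :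
    ‖covDeriv C A ((F₁ ∘ₗ avgQkAdj C A l ∘ₗ M ∘ₗ avgQkLin C A l ∘ₗ F₃) (dip C A c w)) b‖
      ≤ α₁ * β * α₃ * (((P.L : ℝ) ^ l) ^ P.d)⁻¹ * (P.mesh 0 * ‖w‖) *
          (profile P N ((ρ - σ) / 2) ^ 2 * Real.exp ((ρ - σ) / 2)) *
          Real.exp (-((ρ - σ) / 2 * ((HiggsLattice.Site.tdist b.src c.src : ℝ) / (P.L : ℝ) ^ l))) := by
  refine (norm_covDeriv_comp5_dip_le C A F₁ F₃ F₃' M hadj c w b).trans ?_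
  have hρσ : 0 < ρ - σ := by linarith
  have hL : (0 : ℝ) ≤ (((P.L : ℝ) ^ l) ^ P.d)⁻¹ := inv_nonneg.mpr (pow_nonneg (pow_nonneg (Nat.cast_nonneg _) l) _)
  have hεw : 0 ≤ P.mesh 0 * ‖w‖ := mul_nonneg (P.mesh_pos 0).le (norm_nonneg _)
  have hsum := sum_prod3_le (N := N) hl hρσ (by positivity : 0 ≤ α₁ * β * α₃) b c
    (fun s t => ‖covDeriv C A (F₁ (avgQkAdj C A l (cb P N l s))) b‖ * |mat M s t| *
      ‖covDeriv C A (F₃' (avgQkAdj C A l (cb P N l t))) c‖) ?_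
  · calc (((P.L : ℝ) ^ l) ^ P.d)⁻¹ * (P.mesh 0 * ‖w‖) *
          ∑ s : HiggsLattice.Site P l × Ix N, ∑ t : HiggsLattice.Site P l × Ix N,
            ‖covDeriv C A (F₁ (avgQkAdj C A l (cb P N l s))) b‖ * |mat M s t| *
              ‖covDeriv C A (F₃' (avgQkAdj C A l (cb P N l t))) c‖
        ≤ (((P.L : ℝ) ^ l) ^ P.d)⁻¹ * (P.mesh 0 * ‖w‖) * (α₁ * β * α₃ * (profile P N ((ρ - σ) / 2) ^ 2 * Real.exp ((ρ - σ) / 2)) *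
            Real.exp (-((ρ - σ) / 2 * ((HiggsLattice.Site.tdist b.src c.src : ℝ) / (P.L : ℝ) ^ l)))) :=
          mul_le_mul_of_nonneg_left hsum (mul_nonneg hL hεw)
      _ = _ := by ring
  · intro s t
    by_cases hs : s.1 ∈ S
    · by_cases ht : t.1 ∈ T
      · set x : ℝ := (HiggsLattice.Site.tdist (blockIter l b.src) s.1 : ℝ) with hx
        set y : ℝ := (HiggsLattice.Site.tdist s.1 t.1 : ℝ) with hy
        set z : ℝ := (HiggsLattice.Site.tdist (blockIter l c.src) t.1 : ℝ) with hz
        have hy0 : 0 ≤ y := Nat.cast_nonneg _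
        have ex : Real.exp (-(ρ * x)) * Real.exp (σ * x) = Real.exp (-((ρ - σ) * x)) := by
          rw [← Real.exp_add]; ring_nf
        have ez : Real.exp (-(ρ * z)) * Real.exp (σ * z) = Real.exp (-((ρ - σ) * z)) := by
          rw [← Real.exp_add]; ring_nf
        have ey : Real.exp (-(ρ * y)) ≤ Real.exp (-((ρ - σ) * y)) := Real.exp_le_exp.mpr (by nlinarith)
        calc ‖covDeriv C A (F₁ (avgQkAdj C A l (cb P N l s))) b‖ * |mat M s t| *
              ‖covDeriv C A (F₃' (avgQkAdj C A l (cb P N l t))) c‖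
            ≤ α₁ * Real.exp (-(ρ * x)) * (β * Real.exp (-(ρ * y)) * (Real.exp (σ * x) * Real.exp (σ * z))) *
                (α₃ * Real.exp (-(ρ * z))) :=
              mul_le_mul (mul_le_mul (h1 s hs) (hM s t hs ht) (abs_nonneg _) (by positivity)) (h3 t ht) (norm_nonneg _)
                (by positivity)
          _ = α₁ * β * α₃ * ((Real.exp (-(ρ * x)) * Real.exp (σ * x)) * Real.exp (-(ρ * y)) *
                (Real.exp (-(ρ * z)) * Real.exp (σ * z))) := by ring
          _ = α₁ * β * α₃ * (Real.exp (-((ρ - σ) * x)) * Real.exp (-(ρ * y)) * Real.exp (-((ρ - σ) * z))) := by rw [ex, ez]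
          _ ≤ α₁ * β * α₃ * (Real.exp (-((ρ - σ) * x)) * Real.exp (-((ρ - σ) * y)) * Real.exp (-((ρ - σ) * z))) := by
              gcongr
      · rw [hT t ht, norm_zero, mul_zero]
        positivity
    · rw [hS s hs, norm_zero, zero_mul, zero_mul]
      positivity

end EngineG

/-! ## §2 The kernels in the block basis at a fixed bond; the telescoping of `δ(G_jQ_j^*C_jQ_jG_j)` -/

section KernelsR

variable (C : ChargeData N) (A : HiggsLattice.VecField P 0) {l : ℕ}

/-- The decay factor at the block distance. [folklore] -/
private theorem exp_blockDist_le (x : HiggsLattice.Site P 0) (y : HiggsLattice.Site P l) {δ : ℝ} (hδ : 0 ≤ δ) :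
    Real.exp (-(δ * (max 0 ((P.L : ℝ) ^ l * (HiggsLattice.Site.tdist (blockIter l x) y : ℝ) - ((P.L : ℝ) ^ l - 1))
        / (P.L : ℝ) ^ l)))
      ≤ Real.exp δ * Real.exp (-(δ * (HiggsLattice.Site.tdist (blockIter l x) y : ℝ))) := by
  rw [← Real.exp_add]
  apply Real.exp_le_exp.mpr
  have hT : (0 : ℝ) < (P.L : ℝ) ^ l := pow_pos (by exact_mod_cast P.hL) l
  set t : ℝ := (HiggsLattice.Site.tdist (blockIter l x) y : ℝ) with ht
  have h2 : t - 1 ≤ max 0 ((P.L : ℝ) ^ l * t - ((P.L : ℝ) ^ l - 1)) / (P.L : ℝ) ^ l := by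
    rw [le_div_iff₀ hT]
    have h1 : (P.L : ℝ) ^ l * t - ((P.L : ℝ) ^ l - 1) ≤ max 0 ((P.L : ℝ) ^ l * t - ((P.L : ℝ) ^ l - 1)) :=
      le_max_right _ _
    nlinarith
  nlinarith [mul_le_mul_of_nonneg_left h2 hδ]

/-- **A kernel in the block basis AT A FIXED BOND**, for any linear map `F` on `ε`-fields whose derivative at `b` obeys a support-distance
bound (the shape of (I.2.25)/(I.2.26), derivative members): `‖(D^ε_AFQ_l^*e_s)(b)‖ ≤ c_Fe^{δ}√N·e^{−δ|b_l − y_s|}` (the source `Q_l^*e_s` is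
supported in the block `B^l(y_s)`, at distance `≥ L^l|b_l−y_s| − (L^l−1)` from `b`, and has sup norm `≤ √N`).
[cite: Balaban1982Higgs1, Prop. 2.1 (2.25), (2.26) p.610, (1.20) p.607] -/
theorem norm_covDeriv_F_avgQkAdj_cb_le (hl : l ≤ P.K) (F : ScalarField P 0 N →ₗ[ℝ] ScalarField P 0 N) {cF δ : ℝ} (hcF : 0 ≤ cF)
    (hδ : 0 ≤ δ) {b : HiggsLattice.PBond P 0}
    (hDF : ∀ (g : ScalarField P 0 N) (M D : ℝ), (∀ x, ‖g x‖ ≤ M) → 0 ≤ D →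
      (∀ z, g z ≠ 0 → D ≤ (HiggsLattice.Site.tdist b.src z : ℝ)) →
        ‖covDeriv C A (F g) b‖ ≤ cF * Real.exp (-(δ * (D / (P.L : ℝ) ^ l))) * M)
    (s : HiggsLattice.Site P l × Ix N) :
    ‖covDeriv C A (F (avgQkAdj C A l (cb P N l s))) b‖
      ≤ cF * Real.exp δ * Real.sqrt N * Real.exp (-(δ * (HiggsLattice.Site.tdist (blockIter l b.src) s.1 : ℝ))) := by
  set D : ℝ := max 0 ((P.L : ℝ) ^ l * (HiggsLattice.Site.tdist (blockIter l b.src) s.1 : ℝ) - ((P.L : ℝ) ^ l - 1)) with hD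
  have h := hDF (avgQkAdj C A l (cb P N l s)) (Real.sqrt N) D (norm_avgQkAdj_cb_le C A s) (le_max_left _ _)
    (fun z hz => blockDist_le_tdist hl b.src s.1 (blockIter_eq_of_avgQkAdj_cb_ne_zero C A s hz))
  refine h.trans ?_
  have he := exp_blockDist_le (P := P) b.src s.1 hδ
  have hsq : 0 ≤ Real.sqrt (N : ℝ) := Real.sqrt_nonneg _
  calc cF * Real.exp (-(δ * (D / (P.L : ℝ) ^ l))) * Real.sqrt N
      ≤ cF * (Real.exp δ * Real.exp (-(δ * (HiggsLattice.Site.tdist (blockIter l b.src) s.1 : ℝ)))) * Real.sqrt N :=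
        mul_le_mul_of_nonneg_right (mul_le_mul_of_nonneg_left he hcF) hsq
    _ = _ := by ring

variable (Ω Ω₂ : Finset (HiggsLattice.Site P 0)) (msq a : ℝ)

/-- **For nested block unions `Ω₂ ⊆ Ω`, a source outside `Ω^{(l)}` does not reach a bond of `Ω₂` through `δG = G^ε_l(Ω) − G^ε_l(Ω₂)` either**
(this seat's `B3Ineq210MixedRegularRegion.covDeriv_G_avgQkAdj_cb_eq_zero_R` for each region). [cite: Balaban1982Higgs1, (2.20), (2.26) p.610] -/
theorem covDeriv_deltaG_cb_eq_zero (hmsq : 0 < msq) (hak : 0 ≤ B1.aSeq a P.L l) (hsub : Ω₂ ⊆ Ω)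
    (hΩ : ∀ x x' : HiggsLattice.Site P 0, blockIter l x = blockIter l x' → (x ∈ Ω ↔ x' ∈ Ω))
    (hΩ₂ : ∀ x x' : HiggsLattice.Site P 0, blockIter l x = blockIter l x' → (x ∈ Ω₂ ↔ x' ∈ Ω₂))
    (s : HiggsLattice.Site P l × Ix N) (hs : s.1 ∉ levelSet l Ω) {b : HiggsLattice.PBond P 0} (hb₁ : b.src ∈ Ω₂) (hb₂ : b.tgt ∈ Ω₂) :
    covDeriv C A ((propagatorK C Ω A msq a l - propagatorK C Ω₂ A msq a l) (avgQkAdj C A l (cb P N l s))) b = 0 := by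
  have hs₂ : s.1 ∉ levelSet l Ω₂ := fun h => hs (levelSet_mono hsub h)
  rw [LinearMap.sub_apply, covDeriv_sub', covDeriv_G_avgQkAdj_cb_eq_zero_R C Ω A msq a hmsq hak hΩ s hs (hsub hb₁) (hsub hb₂),
    covDeriv_G_avgQkAdj_cb_eq_zero_R C Ω₂ A msq a hmsq hak hΩ₂ s hs₂ hb₁ hb₂, sub_zero]

/-- Additivity of the covariant derivative in the field. [cite: Balaban1982Higgs1, (1.7) p.605] -/
theorem covDeriv_add' (u v : ScalarField P 0 N) (b : HiggsLattice.PBond P 0) :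
    covDeriv C A (u + v) b = covDeriv C A u b + covDeriv C A v b := by
  have h := covDeriv_sub' C A (u + v) v b
  rw [add_sub_cancel_right] at h
  rw [eq_sub_iff_add_eq] at h
  exact h.symm

/-- **THE TELESCOPING of the difference of the region terms of (I.2.43)**:
`G Q^*C Q G − G₂Q^*C₂QG₂ = δG·Q^*CQ·G + G₂·Q^*CQ·δG + G₂·Q^*δC·Q·G₂` with `G = G^ε_l(Ω)`, `G₂ = G^ε_l(Ω₂)`, `C = C^{(l)}(Ω)`, `C₂ = C^{(l)}(Ω₂)`,
`δG = G − G₂`, `δC = C − C₂` (r14's `sandwichR`). [cite: Balaban1982Higgs1, (2.43) p.612, (2.26) p.610] [cite: Balaban1983Higgs3, (2.6) p.424] -/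
theorem sandwichR_sub_eq (l : ℕ) :
    sandwichR C Ω A msq a l - sandwichR C Ω₂ A msq a l
      = (propagatorK C Ω A msq a l - propagatorK C Ω₂ A msq a l) ∘ₗ avgQkAdj C A l ∘ₗ fluctCovA C Ω A msq a l
          ∘ₗ avgQkLin C A l ∘ₗ propagatorK C Ω A msq a l
        + propagatorK C Ω₂ A msq a l ∘ₗ avgQkAdj C A l ∘ₗ fluctCovA C Ω A msq a l ∘ₗ avgQkLin C A l
          ∘ₗ (propagatorK C Ω A msq a l - propagatorK C Ω₂ A msq a l)
        + propagatorK C Ω₂ A msq a l ∘ₗ avgQkAdj C A l ∘ₗ (fluctCovA C Ω A msq a l - fluctCovA C Ω₂ A msq a l)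
          ∘ₗ avgQkLin C A l ∘ₗ propagatorK C Ω₂ A msq a l := by
  apply LinearMap.ext
  intro φ
  simp only [sandwichR, LinearMap.comp_apply, LinearMap.sub_apply, LinearMap.add_apply, map_sub]
  abel

end KernelsR

/-! ## §3 The difference of the region sandwiches on a dipole source, differentiated, at fixed bonds of `Ω₂` -/

section DeltaSandwichR

variable (C : ChargeData N) (Ω Ω₂ : Finset (HiggsLattice.Site P 0)) (A : HiggsLattice.VecField P 0) (msq a : ℝ) {l : ℕ}

/-- a decay bound absorbs a growth allowance `≥ 1`. [folklore] -/
private theorem le_mul_growth {u β ρ σ y x z : ℝ} (hβ : 0 ≤ β) (hσ : 0 ≤ σ) (hx : 0 ≤ x) (hz : 0 ≤ z)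
    (h : u ≤ β * Real.exp (-(ρ * y))) :
    u ≤ β * Real.exp (-(ρ * y)) * (Real.exp (σ * x) * Real.exp (σ * z)) := by
  refine h.trans (le_mul_of_one_le_right (mul_nonneg hβ (Real.exp_pos _).le) ?_)
  exact one_le_mul_of_one_le_of_one_le (Real.one_le_exp (by positivity)) (Real.one_le_exp (by positivity))

/-- **`δ(G_lQ_l^*C_lQ_lG_l)` ON A DIPOLE SOURCE, DIFFERENTIATED, AT BONDS `b, c` OF `Ω₂`** (`Ω₂ ⊆ Ω` unions of `L^l`-blocks): with the
kernels in the block basis at the two fixed bonds — `δG = G^ε_l(Ω) − G^ε_l(Ω₂)` at `b` and at `c` (constants `α_δb`, `α_δc`, into which the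
caller folds the (I.2.26) smallness), `G^ε_l(Ω)` at `c`, `G^ε_l(Ω₂)` at `b` and at `c` ((I.2.25)), `C^{(l)}(Ω)` on `Ω^{(l)} × Ω^{(l)}` ((I.2.34)) and
`δC = C^{(l)}(Ω) − C^{(l)}(Ω₂)` on `Ω₂^{(l)} × Ω₂^{(l)}` with a growth allowance `σ` ((I.2.35)/(I.2.38), the caller folds `e^{−σ·dist}` in `β′`) —
the telescoped sum obeys `‖(D^ε_A δ(GQ^*CQG) dip_c w)(b)‖ ≤ (α_δb·β·α_Ωc + α_2b·β·α_δc + α_2b·β′·α_2c)·L^{−ld}ε‖w‖·K²e^{(ρ−σ)/2}·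
e^{−((ρ−σ)/2)|b−c|/L^l}`. [cite: Balaban1982Higgs1, (2.43) p.612, Prop. 2.1 (2.25), (2.26) p.610, Prop. 2.3 (2.34), (2.38) pp.611–612]
[cite: Balaban1983Higgs3, (2.5)–(2.6) p.424] -/
theorem norm_covDeriv_deltaSandwich_dip_le (hl : l ≤ P.K) (hmsq : 0 < msq) (hak : 0 ≤ B1.aSeq a P.L l) (hsub : Ω₂ ⊆ Ω)
    (hΩ : ∀ x x' : HiggsLattice.Site P 0, blockIter l x = blockIter l x' → (x ∈ Ω ↔ x' ∈ Ω))
    (hΩ₂ : ∀ x x' : HiggsLattice.Site P 0, blockIter l x = blockIter l x' → (x ∈ Ω₂ ↔ x' ∈ Ω₂))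
    {b c : HiggsLattice.PBond P 0} (hb₁ : b.src ∈ Ω₂) (hb₂ : b.tgt ∈ Ω₂) (hc₁ : c.src ∈ Ω₂) (hc₂ : c.tgt ∈ Ω₂) (w : E N)
    {αδb αΩc α₂b αδc α₂c β β' ρ σ : ℝ} (hαδb : 0 ≤ αδb) (hαΩc : 0 ≤ αΩc) (hα₂b : 0 ≤ α₂b) (hαδc : 0 ≤ αδc)
    (hα₂c : 0 ≤ α₂c) (hβ : 0 ≤ β) (hβ' : 0 ≤ β') (hρ : 0 < ρ) (hσ : 0 ≤ σ) (hσρ : 2 * σ ≤ ρ)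
    (hdGb : ∀ s : HiggsLattice.Site P l × Ix N, s.1 ∈ levelSet l Ω →
      ‖covDeriv C A ((propagatorK C Ω A msq a l - propagatorK C Ω₂ A msq a l) (avgQkAdj C A l (cb P N l s))) b‖
        ≤ αδb * Real.exp (-(ρ * (HiggsLattice.Site.tdist (blockIter l b.src) s.1 : ℝ))))
    (hGΩc : ∀ t : HiggsLattice.Site P l × Ix N, t.1 ∈ levelSet l Ω →
      ‖covDeriv C A (propagatorK C Ω A msq a l (avgQkAdj C A l (cb P N l t))) c‖
        ≤ αΩc * Real.exp (-(ρ * (HiggsLattice.Site.tdist (blockIter l c.src) t.1 : ℝ))))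
    (hG₂b : ∀ s : HiggsLattice.Site P l × Ix N, s.1 ∈ levelSet l Ω₂ →
      ‖covDeriv C A (propagatorK C Ω₂ A msq a l (avgQkAdj C A l (cb P N l s))) b‖
        ≤ α₂b * Real.exp (-(ρ * (HiggsLattice.Site.tdist (blockIter l b.src) s.1 : ℝ))))
    (hdGc : ∀ t : HiggsLattice.Site P l × Ix N, t.1 ∈ levelSet l Ω →
      ‖covDeriv C A ((propagatorK C Ω A msq a l - propagatorK C Ω₂ A msq a l) (avgQkAdj C A l (cb P N l t))) c‖
        ≤ αδc * Real.exp (-(ρ * (HiggsLattice.Site.tdist (blockIter l c.src) t.1 : ℝ))))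
    (hG₂c : ∀ t : HiggsLattice.Site P l × Ix N, t.1 ∈ levelSet l Ω₂ →
      ‖covDeriv C A (propagatorK C Ω₂ A msq a l (avgQkAdj C A l (cb P N l t))) c‖
        ≤ α₂c * Real.exp (-(ρ * (HiggsLattice.Site.tdist (blockIter l c.src) t.1 : ℝ))))
    (hC : ∀ s t : HiggsLattice.Site P l × Ix N, s.1 ∈ levelSet l Ω → t.1 ∈ levelSet l Ω →
      |mat (fluctCovA C Ω A msq a l) s t| ≤ β * Real.exp (-(ρ * (HiggsLattice.Site.tdist s.1 t.1 : ℝ))))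
    (hdC : ∀ s t : HiggsLattice.Site P l × Ix N, s.1 ∈ levelSet l Ω₂ → t.1 ∈ levelSet l Ω₂ →
      |mat (fluctCovA C Ω A msq a l - fluctCovA C Ω₂ A msq a l) s t|
        ≤ β' * Real.exp (-(ρ * (HiggsLattice.Site.tdist s.1 t.1 : ℝ))) *
          (Real.exp (σ * (HiggsLattice.Site.tdist (blockIter l b.src) s.1 : ℝ)) *
            Real.exp (σ * (HiggsLattice.Site.tdist (blockIter l c.src) t.1 : ℝ)))) :
    ‖covDeriv C A ((sandwichR C Ω A msq a l - sandwichR C Ω₂ A msq a l) (dip C A c w)) b‖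
      ≤ (αδb * β * αΩc + α₂b * β * αδc + α₂b * β' * α₂c) * (((P.L : ℝ) ^ l) ^ P.d)⁻¹ * (P.mesh 0 * ‖w‖) *
          (profile P N ((ρ - σ) / 2) ^ 2 * Real.exp ((ρ - σ) / 2)) *
          Real.exp (-((ρ - σ) / 2 * ((HiggsLattice.Site.tdist b.src c.src : ℝ) / (P.L : ℝ) ^ l))) := by
  set R : ℝ := (((P.L : ℝ) ^ l) ^ P.d)⁻¹ * (P.mesh 0 * ‖w‖) * (profile P N ((ρ - σ) / 2) ^ 2 * Real.exp ((ρ - σ) / 2)) *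
    Real.exp (-((ρ - σ) / 2 * ((HiggsLattice.Site.tdist b.src c.src : ℝ) / (P.L : ℝ) ^ l))) with hR
  rw [sandwichR_sub_eq, LinearMap.add_apply, LinearMap.add_apply, covDeriv_add', covDeriv_add']
  -- the three telescoped terms
  have hT1 : ‖covDeriv C A (((propagatorK C Ω A msq a l - propagatorK C Ω₂ A msq a l) ∘ₗ avgQkAdj C A l ∘ₗ
      fluctCovA C Ω A msq a l ∘ₗ avgQkLin C A l ∘ₗ propagatorK C Ω A msq a l) (dip C A c w)) b‖ ≤ αδb * β * αΩc * R := by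
    have h := norm_covDeriv_comp5_dip_le_of_kernels C A hl (propagatorK C Ω A msq a l - propagatorK C Ω₂ A msq a l)
      (propagatorK C Ω A msq a l) (propagatorK C Ω A msq a l) (fluctCovA C Ω A msq a l)
      (fun t q => mat_QG_eq_R C Ω A msq a t q) (levelSet l Ω) (levelSet l Ω) (b := b) (c := c) w
      hαδb hαΩc hβ hρ hσ hσρ
      (fun s hs => covDeriv_deltaG_cb_eq_zero C A Ω Ω₂ msq a hmsq hak hsub hΩ hΩ₂ s hs hb₁ hb₂)
      (fun t ht => covDeriv_G_avgQkAdj_cb_eq_zero_R C Ω A msq a hmsq hak hΩ t ht (hsub hc₁) (hsub hc₂))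
      hdGb hGΩc (fun s t hs ht => le_mul_growth hβ hσ (Nat.cast_nonneg _) (Nat.cast_nonneg _) (hC s t hs ht))
    rw [hR]; linarith [h]
  have hT2 : ‖covDeriv C A ((propagatorK C Ω₂ A msq a l ∘ₗ avgQkAdj C A l ∘ₗ fluctCovA C Ω A msq a l ∘ₗ avgQkLin C A l ∘ₗ
      (propagatorK C Ω A msq a l - propagatorK C Ω₂ A msq a l)) (dip C A c w)) b‖ ≤ α₂b * β * αδc * R := by
    have h := norm_covDeriv_comp5_dip_le_of_kernels C A hl (propagatorK C Ω₂ A msq a l)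
      (propagatorK C Ω A msq a l - propagatorK C Ω₂ A msq a l) (propagatorK C Ω A msq a l - propagatorK C Ω₂ A msq a l)
      (fluctCovA C Ω A msq a l) (fun t q => mat_Q_deltaG_eq C A Ω Ω₂ msq a t q) (levelSet l Ω₂) (levelSet l Ω)
      (b := b) (c := c) w hα₂b hαδc hβ hρ hσ hσρ
      (fun s hs => covDeriv_G_avgQkAdj_cb_eq_zero_R C Ω₂ A msq a hmsq hak hΩ₂ s hs hb₁ hb₂)
      (fun t ht => covDeriv_deltaG_cb_eq_zero C A Ω Ω₂ msq a hmsq hak hsub hΩ hΩ₂ t ht hc₁ hc₂)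
      hG₂b hdGc (fun s t hs ht => le_mul_growth hβ hσ (Nat.cast_nonneg _) (Nat.cast_nonneg _)
        (hC s t (levelSet_mono hsub hs) ht))
    rw [hR]; linarith [h]
  have hT3 : ‖covDeriv C A ((propagatorK C Ω₂ A msq a l ∘ₗ avgQkAdj C A l ∘ₗ
      (fluctCovA C Ω A msq a l - fluctCovA C Ω₂ A msq a l) ∘ₗ avgQkLin C A l ∘ₗ propagatorK C Ω₂ A msq a l) (dip C A c w)) b‖
        ≤ α₂b * β' * α₂c * R := by
    have h := norm_covDeriv_comp5_dip_le_of_kernels C A hl (propagatorK C Ω₂ A msq a l) (propagatorK C Ω₂ A msq a l)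
      (propagatorK C Ω₂ A msq a l) (fluctCovA C Ω A msq a l - fluctCovA C Ω₂ A msq a l)
      (fun t q => mat_QG_eq_R C Ω₂ A msq a t q) (levelSet l Ω₂) (levelSet l Ω₂) (b := b) (c := c) w
      hα₂b hα₂c hβ' hρ hσ hσρ
      (fun s hs => covDeriv_G_avgQkAdj_cb_eq_zero_R C Ω₂ A msq a hmsq hak hΩ₂ s hs hb₁ hb₂)
      (fun t ht => covDeriv_G_avgQkAdj_cb_eq_zero_R C Ω₂ A msq a hmsq hak hΩ₂ t ht hc₁ hc₂)
      hG₂b hG₂c hdC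
    rw [hR]; linarith [h]
  calc ‖covDeriv C A (((propagatorK C Ω A msq a l - propagatorK C Ω₂ A msq a l) ∘ₗ avgQkAdj C A l ∘ₗ
          fluctCovA C Ω A msq a l ∘ₗ avgQkLin C A l ∘ₗ propagatorK C Ω A msq a l) (dip C A c w)) b +
        covDeriv C A ((propagatorK C Ω₂ A msq a l ∘ₗ avgQkAdj C A l ∘ₗ fluctCovA C Ω A msq a l ∘ₗ avgQkLin C A l ∘ₗ
          (propagatorK C Ω A msq a l - propagatorK C Ω₂ A msq a l)) (dip C A c w)) b +
        covDeriv C A ((propagatorK C Ω₂ A msq a l ∘ₗ avgQkAdj C A l ∘ₗ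
          (fluctCovA C Ω A msq a l - fluctCovA C Ω₂ A msq a l) ∘ₗ avgQkLin C A l ∘ₗ propagatorK C Ω₂ A msq a l)
          (dip C A c w)) b‖
      ≤ αδb * β * αΩc * R + α₂b * β * αδc * R + α₂b * β' * α₂c * R :=
        (norm_add_le _ _).trans (add_le_add ((norm_add_le _ _).trans (add_le_add hT1 hT2)) hT3)
    _ = _ := by rw [hR]; ring

end DeltaSandwichR

/-! ## §4 The pieces: `ε^{−d}Σ_i‖(D^ε_{A,μ}[G^η_{(j)}(Ω,A) − G^η_{(j)}(Ω₂,A)]D^{ε*}_{A,ν})(x,x′)e_i‖`, piece by piece, at bonds of `Ω₂` -/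

section PiecesR

variable (C : ChargeData N) (Ω Ω₂ : Finset (HiggsLattice.Site P 0)) (A : HiggsLattice.VecField P 0) (msq : ℝ) {a : ℝ} {k j : ℕ}

/-- **The twice-differentiated kernel of `δG^η_{(j)} = G^η_{(j)}(Ω,A) − G^η_{(j)}(Ω₂,A)`** in the column-sum norm:
`ε^{−d}·ε^{−1}·Σ_i‖(D^ε_A [G^η_{(j)}(Ω,A) − G^η_{(j)}(Ω₂,A)](dip_{⟨x′,ν⟩}e_i))(⟨x,μ⟩)‖` — p40's dipole realises `ε·D^{ε*}_{A,ν}` at `⟨x′,ν⟩`, the pieces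
are r14's `pieceR` for the two regions (so that `Σ_j` of the operators inside is `G_k(Ω,A) − G_k(Ω₂,A) = δG_k(Ω,Ω₂,A)`, r14's `sum_pieceR`).
[cite: Balaban1983Higgs3, p.414, (2.5)–(2.6) p.424, (2.10) p.426] -/
def mixedDeltaTermR (a : ℝ) (k j : ℕ) (μ ν : Fin P.d) (x x' : HiggsLattice.Site P 0) : ℝ :=
  (P.mesh 0 ^ P.d)⁻¹ * ((P.mesh 0)⁻¹ *
    ∑ i : Ix N, ‖covDeriv C A ((pieceR C Ω A msq a k j - pieceR C Ω₂ A msq a k j) (dip C A ⟨x', ν⟩ (onb N i))) ⟨x, μ⟩‖)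

variable {C Ω Ω₂ A msq}

/-- The kernel norm is non-negative. [cite: Balaban1983Higgs3, (2.5) p.424] -/
theorem mixedDeltaTermR_nonneg (a : ℝ) (k j : ℕ) (μ ν : Fin P.d) (x x' : HiggsLattice.Site P 0) :
    0 ≤ mixedDeltaTermR C Ω Ω₂ A msq a k j μ ν x x' :=
  mul_nonneg (inv_nonneg.mpr (pow_nonneg (P.mesh_pos 0).le _))
    (mul_nonneg (inv_nonneg.mpr (P.mesh_pos 0).le) (Finset.sum_nonneg fun _ _ => norm_nonneg _))

/-- scaling bookkeeping: `ε^{−d}·L^{−jd} = (L^jε)^{−d}`. [cite: Balaban1982Higgs1, (1.19) p.607] -/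
private theorem inv_mesh_zero_pow_mul' (j : ℕ) :
    (P.mesh 0 ^ P.d)⁻¹ * (((P.L : ℝ) ^ j) ^ P.d)⁻¹ = (P.mesh j ^ P.d)⁻¹ := by
  rw [mesh_eq_pow_mul P j, mul_pow, mul_inv, mul_comm]

variable (C Ω Ω₂ A msq)

/-- **Piece `j = 0`** (`G^η_{(0)} = G^ε_1`): `ε^{−d}Σ_i‖(D^ε_A[G^ε_1(Ω,A) − G^ε_1(Ω₂,A)]D^{ε*}_A)(x,x′)e_i‖ ≤ 2N·c_δL·e^{ρ}·ε^{−d}·e^{−ρ|x−x′|/L}` from an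
(I.2.26)-type derivative bound of `δG^ε_1` at the bond `⟨x,μ⟩` (the caller folds the smallness `e^{−δ·dist(x,Ω₂ᶜ)/L}` into `c_δ`), applied to the
dipole source (sup `≤ 2`, support `{x′, x′+εe_ν}` at distance `≥ |x−x′| − 1`). [cite: Balaban1983Higgs3, (2.5)–(2.6) p.424]
[cite: Balaban1982Higgs1, Prop. 2.1 (2.26) p.610] -/
theorem mixedDelta_piece_zero_le {cδ ρ : ℝ} (hcδ : 0 ≤ cδ) (hρ : 0 ≤ ρ) {x : HiggsLattice.Site P 0} {μ : Fin P.d}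
    (hdG : ∀ (g : ScalarField P 0 N) (M D : ℝ), (∀ y, ‖g y‖ ≤ M) → 0 ≤ D →
      (∀ z, g z ≠ 0 → D ≤ (HiggsLattice.Site.tdist x z : ℝ)) →
        ‖covDeriv C A ((propagatorK C Ω A msq a 1 - propagatorK C Ω₂ A msq a 1) g) ⟨x, μ⟩‖
          ≤ cδ * P.mesh 1 * Real.exp (-(ρ * (D / (P.L : ℝ) ^ 1))) * M)
    (ν : Fin P.d) (x' : HiggsLattice.Site P 0) :
    mixedDeltaTermR C Ω Ω₂ A msq a k 0 μ ν x x'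
      ≤ ((N : ℝ) * 2 * cδ * (P.L : ℝ) * Real.exp ρ) * (P.mesh 0 ^ P.d)⁻¹ *
          Real.exp (-(ρ * ((HiggsLattice.Site.tdist x x' : ℝ) / (P.L : ℝ) ^ 1))) := by
  set X := Real.exp (-(ρ * ((HiggsLattice.Site.tdist x x' : ℝ) / (P.L : ℝ) ^ 1))) with hX
  set D : ℝ := max 0 ((HiggsLattice.Site.tdist x x' : ℝ) - 1) with hD
  have hL1 : (1 : ℝ) ≤ P.L := by exact_mod_cast P.hL
  have hm0 : 0 < P.mesh 0 := P.mesh_pos 0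
  have hexp : Real.exp (-(ρ * (D / (P.L : ℝ) ^ 1))) ≤ Real.exp ρ * X := by
    rw [hX, ← Real.exp_add]
    apply Real.exp_le_exp.mpr
    rw [pow_one]
    have hL0 : (0 : ℝ) < P.L := by linarith
    have h1 : (HiggsLattice.Site.tdist x x' : ℝ) - 1 ≤ D := le_max_right _ _
    have h2 : ρ * (((HiggsLattice.Site.tdist x x' : ℝ) - 1) / P.L) ≤ ρ * (D / P.L) :=
      mul_le_mul_of_nonneg_left (div_le_div_of_nonneg_right h1 hL0.le) hρ
    have h3 : ρ / P.L ≤ ρ := div_le_self hρ hL1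
    have h4 : ρ * (((HiggsLattice.Site.tdist x x' : ℝ) - 1) / P.L)
        = ρ * ((HiggsLattice.Site.tdist x x' : ℝ) / P.L) - ρ / P.L := by ring
    linarith
  have h1 : ∀ i : Ix N, ‖covDeriv C A ((pieceR C Ω A msq a k 0 - pieceR C Ω₂ A msq a k 0) (dip C A ⟨x', ν⟩ (onb N i))) ⟨x, μ⟩‖
      ≤ cδ * P.mesh 1 * (Real.exp ρ * X) * 2 := by
    intro i
    rw [pieceR_zero, pieceR_zero]
    have h := hdG (dip C A ⟨x', ν⟩ (onb N i)) 2 D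
      (fun y => by have := norm_dip_le (C := C) (A := A) ⟨x', ν⟩ (onb N i) y; rwa [norm_onb, mul_one] at this)
      (le_max_left _ _) (fun z hz => dip_support_dist C A ν x x' (onb N i) hz)
    refine h.trans ?_
    exact mul_le_mul_of_nonneg_right (mul_le_mul_of_nonneg_left hexp (mul_nonneg hcδ (P.mesh_pos 1).le)) (by norm_num)
  have hsum : ∑ i : Ix N, ‖covDeriv C A ((pieceR C Ω A msq a k 0 - pieceR C Ω₂ A msq a k 0) (dip C A ⟨x', ν⟩ (onb N i))) ⟨x, μ⟩‖
      ≤ N * (cδ * P.mesh 1 * (Real.exp ρ * X) * 2) := by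
    refine (Finset.sum_le_sum fun i _ => h1 i).trans ?_
    rw [Finset.sum_const, card_Ix, nsmul_eq_mul]
  unfold mixedDeltaTermR
  refine (mul_le_mul_of_nonneg_left (mul_le_mul_of_nonneg_left hsum (inv_nonneg.mpr hm0.le))
    (inv_nonneg.mpr (pow_nonneg hm0.le _))).trans (le_of_eq ?_)
  rw [mesh_eq_pow_mul P 1, pow_one]
  field_simp

/-- **Piece `1 ≤ j < k`** at bonds `⟨x,μ⟩`, `⟨x′,ν⟩` of `Ω₂`: with the seven kernel bounds of §3 at these two bonds, in units of `L^jε` (outer kernels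
`∝ L^jε`, middle kernels `∝ (L^jε)²`), `ε^{−d}Σ_i‖(D^ε_A δG^η_{(j)} D^{ε*}_A)(x,x′)e_i‖ ≤ N·a²·(c_δb·β·c_Ω + c_2·β·c_δc + c_2·β′·c_2′)·K²e^{(ρ−σ)/2}·(L^jε)^{−d}·
e^{−((ρ−σ)/2)|x−x′|/L^j}` — the scaling `ε^{−d}·ε^{−1}·a_j²(L^jε)^{−4}·(L^jε)^{1+2+1}·L^{−jd}·ε = a_j²(L^jε)^{−d}` of the print's «rescaling from the
η-lattice to the L^{−j}-lattice». [cite: Balaban1983Higgs3, (2.5)–(2.6) p.424, (2.10) p.426] [cite: Balaban1982Higgs1, (2.43) p.612] -/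
theorem mixedDelta_piece_pos_le (ha : 0 < a) (hL1 : 1 < P.L) (hj1 : 1 ≤ j) (hjk : j < k) (hjK : j ≤ P.K) (hmsq : 0 < msq)
    (hsub : Ω₂ ⊆ Ω) (hΩ : ∀ x x' : HiggsLattice.Site P 0, blockIter j x = blockIter j x' → (x ∈ Ω ↔ x' ∈ Ω))
    (hΩ₂ : ∀ x x' : HiggsLattice.Site P 0, blockIter j x = blockIter j x' → (x ∈ Ω₂ ↔ x' ∈ Ω₂))
    {x x' : HiggsLattice.Site P 0} {μ ν : Fin P.d} (hx₁ : x ∈ Ω₂) (hx₂ : x.shift μ ∈ Ω₂) (hx'₁ : x' ∈ Ω₂) (hx'₂ : x'.shift ν ∈ Ω₂)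
    {cδb cΩ c₂ cδc c₂' β β' ρ σ : ℝ} (hcδb : 0 ≤ cδb) (hcΩ : 0 ≤ cΩ) (hc₂ : 0 ≤ c₂) (hcδc : 0 ≤ cδc) (hc₂' : 0 ≤ c₂')
    (hβ : 0 ≤ β) (hβ' : 0 ≤ β') (hρ : 0 < ρ) (hσ : 0 ≤ σ) (hσρ : 2 * σ ≤ ρ)
    (hdGb : ∀ s : HiggsLattice.Site P j × Ix N, s.1 ∈ levelSet j Ω →
      ‖covDeriv C A ((propagatorK C Ω A msq a j - propagatorK C Ω₂ A msq a j) (avgQkAdj C A j (cb P N j s))) ⟨x, μ⟩‖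
        ≤ cδb * P.mesh j * Real.exp (-(ρ * (HiggsLattice.Site.tdist (blockIter j x) s.1 : ℝ))))
    (hGΩc : ∀ t : HiggsLattice.Site P j × Ix N, t.1 ∈ levelSet j Ω →
      ‖covDeriv C A (propagatorK C Ω A msq a j (avgQkAdj C A j (cb P N j t))) ⟨x', ν⟩‖
        ≤ cΩ * P.mesh j * Real.exp (-(ρ * (HiggsLattice.Site.tdist (blockIter j x') t.1 : ℝ))))
    (hG₂b : ∀ s : HiggsLattice.Site P j × Ix N, s.1 ∈ levelSet j Ω₂ →
      ‖covDeriv C A (propagatorK C Ω₂ A msq a j (avgQkAdj C A j (cb P N j s))) ⟨x, μ⟩‖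
        ≤ c₂ * P.mesh j * Real.exp (-(ρ * (HiggsLattice.Site.tdist (blockIter j x) s.1 : ℝ))))
    (hdGc : ∀ t : HiggsLattice.Site P j × Ix N, t.1 ∈ levelSet j Ω →
      ‖covDeriv C A ((propagatorK C Ω A msq a j - propagatorK C Ω₂ A msq a j) (avgQkAdj C A j (cb P N j t))) ⟨x', ν⟩‖
        ≤ cδc * P.mesh j * Real.exp (-(ρ * (HiggsLattice.Site.tdist (blockIter j x') t.1 : ℝ))))
    (hG₂c : ∀ t : HiggsLattice.Site P j × Ix N, t.1 ∈ levelSet j Ω₂ →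
      ‖covDeriv C A (propagatorK C Ω₂ A msq a j (avgQkAdj C A j (cb P N j t))) ⟨x', ν⟩‖
        ≤ c₂' * P.mesh j * Real.exp (-(ρ * (HiggsLattice.Site.tdist (blockIter j x') t.1 : ℝ))))
    (hC : ∀ s t : HiggsLattice.Site P j × Ix N, s.1 ∈ levelSet j Ω → t.1 ∈ levelSet j Ω →
      |mat (fluctCovA C Ω A msq a j) s t| ≤ β * P.mesh j ^ 2 * Real.exp (-(ρ * (HiggsLattice.Site.tdist s.1 t.1 : ℝ))))
    (hdC : ∀ s t : HiggsLattice.Site P j × Ix N, s.1 ∈ levelSet j Ω₂ → t.1 ∈ levelSet j Ω₂ →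
      |mat (fluctCovA C Ω A msq a j - fluctCovA C Ω₂ A msq a j) s t|
        ≤ β' * P.mesh j ^ 2 * Real.exp (-(ρ * (HiggsLattice.Site.tdist s.1 t.1 : ℝ))) *
          (Real.exp (σ * (HiggsLattice.Site.tdist (blockIter j x) s.1 : ℝ)) *
            Real.exp (σ * (HiggsLattice.Site.tdist (blockIter j x') t.1 : ℝ)))) :
    mixedDeltaTermR C Ω Ω₂ A msq a k j μ ν x x'
      ≤ ((N : ℝ) * a ^ 2 * (cδb * β * cΩ + c₂ * β * cδc + c₂ * β' * c₂') *
          (profile P N ((ρ - σ) / 2) ^ 2 * Real.exp ((ρ - σ) / 2))) * (P.mesh j ^ P.d)⁻¹ *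
        Real.exp (-((ρ - σ) / 2 * ((HiggsLattice.Site.tdist x x' : ℝ) / (P.L : ℝ) ^ j))) := by
  set X := Real.exp (-((ρ - σ) / 2 * ((HiggsLattice.Site.tdist x x' : ℝ) / (P.L : ℝ) ^ j))) with hX
  set Kp := profile P N ((ρ - σ) / 2) ^ 2 * Real.exp ((ρ - σ) / 2) with hKp
  set S3 := cδb * β * cΩ + c₂ * β * cδc + c₂ * β' * c₂' with hS3
  have hm0 : 0 < P.mesh 0 := P.mesh_pos 0
  have hmj : 0 < P.mesh j := P.mesh_pos j
  have hLj : (0 : ℝ) < (P.L : ℝ) ^ j := pow_pos (by exact_mod_cast P.hL) j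
  have hK : 0 ≤ profile P N ((ρ - σ) / 2) := profile_nonneg' _ (by linarith)
  have hKp0 : 0 ≤ Kp := by rw [hKp]; positivity
  have hS30 : 0 ≤ S3 := by rw [hS3]; positivity
  have hak : 0 ≤ B1.aSeq a P.L j := (B1.aSeq_pos ha (by exact_mod_cast hL1) hj1).le
  -- the engine of §3 at the two bonds, with the mesh powers inside the constants
  have hsw : ∀ i : Ix N, ‖covDeriv C A ((pieceR C Ω A msq a k j - pieceR C Ω₂ A msq a k j) (dip C A ⟨x', ν⟩ (onb N i))) ⟨x, μ⟩‖
      ≤ coeff221 P a j ^ 2 * ((cδb * P.mesh j * (β * P.mesh j ^ 2) * (cΩ * P.mesh j) + c₂ * P.mesh j * (β * P.mesh j ^ 2) *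
          (cδc * P.mesh j) + c₂ * P.mesh j * (β' * P.mesh j ^ 2) * (c₂' * P.mesh j)) * (((P.L : ℝ) ^ j) ^ P.d)⁻¹ *
          (P.mesh 0 * 1) * Kp * X) := by
    intro i
    rw [pieceR_of_pos hj1 hjk, pieceR_of_pos hj1 hjk, LinearMap.sub_apply, LinearMap.smul_apply, LinearMap.smul_apply, ← smul_sub,
      ← LinearMap.sub_apply, covDeriv_smul'', norm_smul, Real.norm_eq_abs, abs_of_nonneg (sq_nonneg _)]
    refine mul_le_mul_of_nonneg_left ?_ (sq_nonneg _)
    have h := norm_covDeriv_deltaSandwich_dip_le C Ω Ω₂ A msq a hjK hmsq hak hsub hΩ hΩ₂ (b := ⟨x, μ⟩) (c := ⟨x', ν⟩)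
      hx₁ hx₂ hx'₁ hx'₂ (onb N i) (by positivity : 0 ≤ cδb * P.mesh j) (by positivity : 0 ≤ cΩ * P.mesh j)
      (by positivity : 0 ≤ c₂ * P.mesh j) (by positivity : 0 ≤ cδc * P.mesh j) (by positivity : 0 ≤ c₂' * P.mesh j)
      (by positivity : 0 ≤ β * P.mesh j ^ 2) (by positivity : 0 ≤ β' * P.mesh j ^ 2) hρ hσ hσρ hdGb hGΩc hG₂b hdGc hG₂c hC hdC
    rw [norm_onb] at h
    rw [hKp, hX]
    exact h
  have hsum : ∑ i : Ix N, ‖covDeriv C A ((pieceR C Ω A msq a k j - pieceR C Ω₂ A msq a k j) (dip C A ⟨x', ν⟩ (onb N i))) ⟨x, μ⟩‖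
      ≤ N * (coeff221 P a j ^ 2 * ((cδb * P.mesh j * (β * P.mesh j ^ 2) * (cΩ * P.mesh j) + c₂ * P.mesh j * (β * P.mesh j ^ 2) *
          (cδc * P.mesh j) + c₂ * P.mesh j * (β' * P.mesh j ^ 2) * (c₂' * P.mesh j)) * (((P.L : ℝ) ^ j) ^ P.d)⁻¹ *
          (P.mesh 0 * 1) * Kp * X)) := by
    refine (Finset.sum_le_sum fun i _ => hsw i).trans ?_
    rw [Finset.sum_const, card_Ix, nsmul_eq_mul]
  unfold mixedDeltaTermR
  refine (mul_le_mul_of_nonneg_left (mul_le_mul_of_nonneg_left hsum (inv_nonneg.mpr hm0.le))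
    (inv_nonneg.mpr (pow_nonneg hm0.le _))).trans ?_
  rw [B1Eq243HiggsModel.coeff221_sq]
  -- the scaling identity
  have hid : (P.mesh 0 ^ P.d)⁻¹ * ((P.mesh 0)⁻¹ * (N * (B1.aSeq a (P.L : ℝ) j ^ 2 * (P.mesh j ^ 4)⁻¹ *
        ((cδb * P.mesh j * (β * P.mesh j ^ 2) * (cΩ * P.mesh j) + c₂ * P.mesh j * (β * P.mesh j ^ 2) * (cδc * P.mesh j) +
          c₂ * P.mesh j * (β' * P.mesh j ^ 2) * (c₂' * P.mesh j)) * (((P.L : ℝ) ^ j) ^ P.d)⁻¹ * (P.mesh 0 * 1) * Kp * X))))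
      = B1.aSeq a (P.L : ℝ) j ^ 2 * (((N : ℝ) * S3 * Kp) * (P.mesh j ^ P.d)⁻¹ * X) := by
    calc (P.mesh 0 ^ P.d)⁻¹ * ((P.mesh 0)⁻¹ * (N * (B1.aSeq a (P.L : ℝ) j ^ 2 * (P.mesh j ^ 4)⁻¹ *
          ((cδb * P.mesh j * (β * P.mesh j ^ 2) * (cΩ * P.mesh j) + c₂ * P.mesh j * (β * P.mesh j ^ 2) * (cδc * P.mesh j) +
            c₂ * P.mesh j * (β' * P.mesh j ^ 2) * (c₂' * P.mesh j)) * (((P.L : ℝ) ^ j) ^ P.d)⁻¹ * (P.mesh 0 * 1) * Kp * X))))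
        = B1.aSeq a (P.L : ℝ) j ^ 2 * (((N : ℝ) * S3 * Kp) * X) *
            ((P.mesh 0 ^ P.d)⁻¹ * (((P.L : ℝ) ^ j) ^ P.d)⁻¹) * ((P.mesh j ^ 4)⁻¹ * P.mesh j ^ 4) *
            ((P.mesh 0)⁻¹ * P.mesh 0) := by rw [hS3]; ring
      _ = _ := by
        rw [inv_mesh_zero_pow_mul', inv_mul_cancel₀ (pow_ne_zero 4 hmj.ne'), inv_mul_cancel₀ hm0.ne']; ring
  rw [hid]
  have hrest : 0 ≤ ((N : ℝ) * S3 * Kp) * (P.mesh j ^ P.d)⁻¹ * X := by positivity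
  calc B1.aSeq a (P.L : ℝ) j ^ 2 * (((N : ℝ) * S3 * Kp) * (P.mesh j ^ P.d)⁻¹ * X)
      ≤ a ^ 2 * (((N : ℝ) * S3 * Kp) * (P.mesh j ^ P.d)⁻¹ * X) := mul_le_mul_of_nonneg_right (aSeq_sq_le ha hL1 hj1) hrest
    _ = _ := by ring

/-- **Pieces `j ≥ k`, `j ≥ 1` vanish** (no such terms in (2.6)). [cite: Balaban1983Higgs3, (2.6) p.424] -/
theorem mixedDeltaTermR_eq_zero_of_le (hj1 : 1 ≤ j) (hkj : k ≤ j) (μ ν : Fin P.d) (x x' : HiggsLattice.Site P 0) :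
    mixedDeltaTermR C Ω Ω₂ A msq a k j μ ν x x' = 0 := by
  unfold mixedDeltaTermR
  simp [pieceR_of_le hj1 hkj, covDeriv_zero'']

end PiecesR

/-! ## §5 The theorem: the mixed kernel of `δG_k(Ω,Ω₂,A)` on nested regions at a regular background, with the printed smallness -/

section MainD

/-- weakening in the exponent. [folklore] -/
private theorem exp_le_exp_of_le' {u v : ℝ} (h : v ≤ u) : Real.exp (-u) ≤ Real.exp (-v) :=
  Real.exp_le_exp.mpr (neg_le_neg h)

/-- Rate weakening in a decay factor. [folklore] -/
private theorem exp_rate_mono' {ρ ρ' u : ℝ} (h : ρ' ≤ ρ) (hu : 0 ≤ u) : Real.exp (-(ρ * u)) ≤ Real.exp (-(ρ' * u)) :=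
  Real.exp_le_exp.mpr (by nlinarith)

/-- the rates of p35's region theorems (`D/(κL^l)`, `κ = 4K₀, 8K₀`) dominate a common rate `δ ≤ 1/κ`. [folklore] -/
private theorem exp_kappa_le {κ δ D Ll : ℝ} (hκ : 0 < κ) (hδ : δ ≤ 1 / κ) (hD : 0 ≤ D) (hLl : 0 < Ll) :
    Real.exp (-(D / (κ * Ll))) ≤ Real.exp (-(δ * (D / Ll))) := by
  apply exp_le_exp_of_le'
  have h1 : D / (κ * Ll) = 1 / κ * (D / Ll) := by
    field_simp
  rw [h1]
  exact mul_le_mul_of_nonneg_right hδ (by positivity)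

/-- **the three-distance squeeze**: `e^{−rD₀/ℓ}·e^{−rT/ℓ} ≤ e^{−(r/2)(T + D₀ + D₀′)/ℓ}` when `D₀′ ≤ T + D₀` (the distance of the second point to
`Ω₂ᶜ` is at most its distance to the first point plus that point's distance to `Ω₂ᶜ`). [folklore] -/
private theorem exp_squeeze {r T D₀ D₀' Ll : ℝ} (hr : 0 ≤ r) (hLl : 0 < Ll) (hD' : D₀' ≤ T + D₀) :
    Real.exp (-(r * (D₀ / Ll))) * Real.exp (-(r * (T / Ll))) ≤ Real.exp (-(r / 2 * ((T + D₀ + D₀') / Ll))) := by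
  rw [← Real.exp_add]
  apply Real.exp_le_exp.mpr
  have key : r / 2 * ((T + D₀ + D₀') / Ll) ≤ r * (D₀ / Ll) + r * (T / Ll) := by
    have h1 : r / 2 * (T + D₀ + D₀') ≤ r * (D₀ + T) := by nlinarith
    calc r / 2 * ((T + D₀ + D₀') / Ll) = (r / 2 * (T + D₀ + D₀')) / Ll := by ring
      _ ≤ (r * (D₀ + T)) / Ll := div_le_div_of_nonneg_right h1 hLl.le
      _ = r * (D₀ / Ll) + r * (T / Ll) := by ring
  linarith

/-- splitting a decay factor. [folklore] -/
private theorem exp_sum3_eq {ρ T u v : ℝ} :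
    Real.exp (-(ρ * (T + u + v))) = Real.exp (-(ρ * T)) * Real.exp (-(ρ * u)) * Real.exp (-(ρ * v)) := by
  rw [← Real.exp_add, ← Real.exp_add]; ring_nf

set_option maxHeartbeats 1600000 in
/-- **B3 (2.5) p. 424 / p. 414, THE TWICE-DIFFERENTIATED KERNEL OF `δG_k(Ω,Ω₂,B̃) = G_k(Ω,B̃) − G_k(Ω₂,B̃)` WITH THE PRINTED SMALLNESS, FOR
NESTED BIG-BLOCK-UNION REGIONS `Ω₂ ⊆ Ω ⊆ T_ε` AT A REGULAR NON-CONSTANT BACKGROUND, AT INTERIOR POINTS OF `Ω₂` — piece by piece over (2.6).**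
For `d ≥ 1`, `L ≥ 2`, `a, m² > 0`, `N` and a regularity constant `c ≥ 0` there is `E₀ > 0` and, for every charge `C = (e, U)` with
`e² ≤ E₀`, a threshold `K₀,min` and for every cube size `K₀ ≥ K₀,min` constants `t, δ₁, C > 0` such that: for every volume `P` of
`HiggsLattice.Params` with these `d, L` and `K₀ ∣ M`, every scale `1 ≤ k ≤ K` with `L^kε ≤ 1` and `3L^kK₀ ≤ |T_ε|_μ`, all regions
`Ω₂ ⊆ Ω ⊆ T_ε` that are unions of `L^kK₀`-cells, every `A` that is `δ_A`-regular on `Ω` with `L^k·δ_A·|e| ≤ t` and `L^k·δ_A ≤ c|e|`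
((I.2.23) in both printed currencies — the second one is the hypothesis of the (I.2.38) input as landed), all pieces `j`, directions
`μ, ν` and INTERIOR points `x, x′` of `Ω₂` (`Interior k K₀ Ω₂`):
`ε^{−d}ε^{−1}Σ_i‖(D^ε_{A,μ}[G^η_{(j)}(Ω,A) − G^η_{(j)}(Ω₂,A)] dip_{⟨x′,ν⟩}e_i)(x)‖ ≤ C·(L^jε)^{−d}·exp(−δ₁·(|x−x′| + dist(x,Ω₂ᶜ) + dist(x′,Ω₂ᶜ))/L^j)`
(`|x−x′| = tdist`, `dist(·,Ω₂ᶜ) = distC Ω₂ ·`, lattice units of `T_ε`; `dist = 0` when `Ω₂ = T_ε`).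
Print, p. 414: *"δG_k(Ω,Ω₂,B̃) = G_k(Ω,B̃) − G_k(Ω₂,B̃) … The bound follows easily from the properties of the propagators G_k(Ω,A) proved in
the next paper"*; (2.5) p. 424: *"‖h δG_k(Ω,Ω₂,B̃) h′‖ ≤ O(1) e^{−δ₀ dist(Ω₂ᶜ, supp h ∪ supp h′)} e^{−δ₀ d(supp h, supp h′)}"*; part I
(2.26) p. 610: *"we have the inequalities (2.24), (2.25) with the additional factor exp(−δ₀dist(supp f, Ωᶜ) − δ₀dist({x,x′},Ωᶜ))"*,
(2.38) p. 612 (the same for `C^{(k)}`).  Route (the print's "follows easily", through (2.6)): for `j ≥ 1` the difference of the terms of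
(I.2.43) telescopes, `δ(G_jQ*C_jQG_j) = δG_j·Q*C_jQ·G_j + G_j(Ω₂)·Q*C_jQ·δG_j + G_j(Ω₂)·Q*δC_j·Q·G_j(Ω₂)` (`sandwichR_sub_eq`); the two
derivatives fall on the outer factors (the right one through p40's dipole and the adjointness `(Q_jF)^* = FQ_j^*`, `norm_covDeriv_comp5_dip_le`):
`δG_j` by Proposition I.2.1 (2.26), derivative member, on big-block regions (p35's `B1Ineq226RegularRegionSum.deltaG_region_reg_decay_sum`,
smallness `e^{−dist(·,Ω₂ᶜ)/(8K₀L^j)}`), `G_j(Ω)`, `G_j(Ω₂)` by (I.2.25) (p35's `norm_covDeriv_propagatorK_region_reg_decay_sum`), `C_j(Ω)` by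
(I.2.34) on `Ω^{(j)}` and `δC_j = [C^{(j)}(Ω) − C^{(j)}_{Ω₂^{(j)}}(Ω)] + [C^{(j)}_{Ω₂^{(j)}}(Ω) − C^{(j)}(Ω₂)]` on `Ω₂^{(j)} × Ω₂^{(j)}` by the
conditioning correction (I.2.35) (p35's `B1Prop23RegularRegionSmall.prop23_regular_region_small`, second member) and by (I.2.38) (r14's
`B1Ineq238RegularRegion.prop23_238_regular_region`), both with the factor `e^{−δ(dist(y,Ω₂^{(j)c}) + dist(y′,Ω₂^{(j)c}))}`, moved to the
end-points by the triangle inequality at the cost of half the rate (`exp_distC_le_of_triangle`, `exp_distC_block_le`); sources in blocks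
outside the regions do not reach their interior (`covDeriv_deltaG_cb_eq_zero`); the three-kernel convolution `sum3_le`; `j = 0`: (I.2.26) at
level `1` on the dipole; finally `e^{−δ dist(x,Ω₂ᶜ)}e^{−δ|x−x′|} ≤ e^{−(δ/2)(|x−x′| + dist(x,Ω₂ᶜ) + dist(x′,Ω₂ᶜ))}` (`exp_squeeze`).
HONEST SCOPE: interior points of `Ω₂` only; `m² > 0`; the hypotheses of r14's v1.1 region member of (2.10) (both (I.2.23) currencies,
`e² ≤ E₀`, because the (I.2.38) input is landed in that currency; constants after the charge data, depending on `K₀`); the kernel entry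
only — the (1.32)-norm of `hδG_kh′` with Hölder quotients and transports, and (1.16), are NOT in this file; no `def … : Prop`, no new
named fact (`mixedDeltaTermR` is a concrete `def`); axioms standard.  CITATION HEADER: cell `lit-balaban`, seat p33 gen 58; SKELETON row
B3.Eq2.5 (owner r15; located member); companion of this seat's `B3Ineq210MixedRegularRegion` (p343340, the same clause for `G^η_{(j)}(Ω,A)`
itself) and of p33 g59's `B3DeltaGkRegularRegion` (value and one-derivative entries of `δG_k`).
[cite: Balaban1983Higgs3, p.414, (2.5)–(2.6) p.424, (2.10) p.426] [cite: Balaban1982Higgs1, Prop. 2.1 (2.23), (2.25), (2.26) p.610,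
Prop. 2.3 (2.34)–(2.35) p.611, (2.38), (2.43) p.612] -/
theorem deltaGk_mixed_regularRegion (d L : ℕ) (hd : 1 ≤ d) (hL : 2 ≤ L) {a : ℝ} (ha : 0 < a) {msq : ℝ} (hmsq : 0 < msq)
    (N : ℕ) {c : ℝ} (hc : 0 ≤ c) :
    ∃ E₀ : ℝ, 0 < E₀ ∧ ∀ (C : ChargeData N), C.e ^ 2 ≤ E₀ →
    ∃ K₀min : ℕ, ∀ K₀ : ℕ, K₀min ≤ K₀ → ∃ t δ₁ Cst : ℝ, 0 < t ∧ 0 < δ₁ ∧ 0 < Cst ∧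
      ∀ (P : HiggsLattice.Params), P.d = d → P.L = L → K₀ ∣ P.M →
      ∀ {k : ℕ}, 1 ≤ k → k ≤ P.K → (∀ μ, 3 * half P k K₀ ≤ P.sitesPerDir 0 μ) → P.mesh k ≤ 1 →
      ∀ (Ω Ω₂ : Finset (HiggsLattice.Site P 0)), IsBigBlockUnion k K₀ Ω → IsBigBlockUnion k K₀ Ω₂ → Ω₂ ⊆ Ω →
      ∀ (A : HiggsLattice.VecField P 0) {δA : ℝ}, 0 ≤ δA →
        (∀ z ∈ Ω, ∀ μ ν : Fin P.d, |A ⟨z.shift ν, μ⟩ - A ⟨z, μ⟩| ≤ δA) →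
        (P.L : ℝ) ^ k * δA * |C.e| ≤ t → (P.L : ℝ) ^ k * δA ≤ c * |C.e| →
        ∀ (j : ℕ) (μ ν : Fin P.d) (x x' : HiggsLattice.Site P 0), Interior k K₀ Ω₂ x → Interior k K₀ Ω₂ x' →
          mixedDeltaTermR C Ω Ω₂ A msq a k j μ ν x x'
            ≤ Cst * (P.mesh j ^ P.d)⁻¹ * Real.exp (-(δ₁ *
                (((HiggsLattice.Site.tdist x x' : ℝ) + distC Ω₂ x + distC Ω₂ x') / (P.L : ℝ) ^ j))) := by
  have hL1 : 1 < L := by omega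
  obtain ⟨E₀, c₄, ρ₄, hE₀, hc₄, hρ₄, h238⟩ := B1Ineq238RegularRegion.prop23_238_regular_region d L hL1 ha hmsq hc N
  refine ⟨E₀, hE₀, fun C hCe => ?_⟩
  obtain ⟨t₀, c₁, ρ₃, ht₀, hc₁, hρ₃, hCov⟩ := B1Prop23RegularRegionSmall.prop23_regular_region_small d L hL1 ha hmsq N
  obtain ⟨K₂, hD⟩ :=
    B1Ineq225DerivRegularRegion.norm_covDeriv_propagatorK_region_reg_decay_sum d L hd hL ha hmsq N C 1 1 1 zero_le_one one_pos
  obtain ⟨K₃, hΔ⟩ := B1Ineq226RegularRegionSum.deltaG_region_reg_decay_sum d L hd hL ha hmsq N C 1 1 1 zero_le_one one_pos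
  refine ⟨max (max K₂ K₃) 1, fun K₀ hK₀ => ?_⟩
  have hK₂ : K₂ ≤ K₀ := (le_max_left _ _).trans ((le_max_left _ _).trans hK₀)
  have hK₃ : K₃ ≤ K₀ := (le_max_right _ _).trans ((le_max_left _ _).trans hK₀)
  have hK₀1 : 1 ≤ K₀ := (le_max_right _ _).trans hK₀
  have hK₀r : (0 : ℝ) < K₀ := by exact_mod_cast hK₀1
  obtain ⟨c₀', e₂, hc₀', he₂, hD⟩ := hD K₀ hK₂
  obtain ⟨c₀'', e₃, hc₀'', he₃, hΔ⟩ := hΔ K₀ hK₃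
  -- the common rate
  obtain ⟨ρ, hρ⟩ : ∃ ρ : ℝ, ρ = min (1 / (8 * (K₀ : ℝ))) (min ρ₃ ρ₄) := ⟨_, rfl⟩
  have hρpos : 0 < ρ := by rw [hρ]; exact lt_min (by positivity) (lt_min hρ₃ hρ₄)
  have hρ8 : ρ ≤ 1 / (8 * K₀) := by rw [hρ]; exact min_le_left _ _
  have hρ4 : ρ ≤ 1 / (4 * K₀) :=
    hρ8.trans (one_div_le_one_div_of_le (by positivity) (by nlinarith))
  have hρ₃' : ρ ≤ ρ₃ := by rw [hρ]; exact (min_le_right _ _).trans (min_le_left _ _)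
  have hρ₄' : ρ ≤ ρ₄ := by rw [hρ]; exact (min_le_right _ _).trans (min_le_right _ _)
  have hLpos : (0 : ℝ) < L := by exact_mod_cast (by omega : 0 < L)
  -- the constants
  obtain ⟨Ecb, hEcb⟩ : ∃ Ecb : ℝ, Ecb = Real.exp ρ * Real.sqrt N := ⟨_, rfl⟩
  have hEcb0 : 0 ≤ Ecb := by rw [hEcb]; positivity
  obtain ⟨Kp, hKp⟩ : ∃ Kp : ℝ, Kp = ((nCol N : ℝ) * B4Sect5Proof.latticeConst d (ρ / 4)) ^ 2 * Real.exp (ρ / 4) := ⟨_, rfl⟩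
  have hKp0 : 0 ≤ Kp := by
    rw [hKp]; exact mul_nonneg (sq_nonneg _) (Real.exp_pos _).le
  obtain ⟨Cz, hCz⟩ : ∃ Cz : ℝ, Cz = (N : ℝ) * 2 * c₀'' * (L : ℝ) * Real.exp ρ := ⟨_, rfl⟩
  have hCz0 : 0 ≤ Cz := by rw [hCz]; positivity
  obtain ⟨Cp, hCp⟩ : ∃ Cp : ℝ, Cp = (N : ℝ) * a ^ 2 * (c₀'' * Ecb * c₁ * (c₀' * Ecb) + c₀' * Ecb * c₁ * (c₀'' * Ecb) +
      c₀' * Ecb * ((c₁ + c₄) * Real.exp (2 * (ρ / 2))) * (c₀' * Ecb)) * Kp := ⟨_, rfl⟩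
  have hCp0 : 0 ≤ Cp := by rw [hCp]; positivity
  refine ⟨min (min e₂ e₃) t₀, ρ / (8 * L), 1 + Cz + Cp, lt_min (lt_min he₂ he₃) ht₀, by positivity, by positivity, ?_⟩
  intro P hPd hPL hK₀M k hk1 hkK h3 hmesh Ω Ω₂ hΩ hΩ₂ hsub A δA hδA hreg ht hc' j μ ν x x' hx hx'
  subst hPd hPL
  have hL1' : 1 < P.L := hL1
  have hLr : 1 < (P.L : ℝ) := by exact_mod_cast hL1'
  have hLge1 : (1 : ℝ) ≤ P.L := hLr.le
  have hte₂ : (P.L : ℝ) ^ k * δA * |C.e| ≤ e₂ := ht.trans ((min_le_left _ _).trans (min_le_left _ _))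
  have hte₃ : (P.L : ℝ) ^ k * δA * |C.e| ≤ e₃ := ht.trans ((min_le_left _ _).trans (min_le_right _ _))
  have htt₀ : (P.L : ℝ) ^ k * δA * |C.e| ≤ t₀ := ht.trans (min_le_right _ _)
  have hreg₂ : ∀ z ∈ Ω₂, ∀ μ ν : Fin P.d, |A ⟨z.shift ν, μ⟩ - A ⟨z, μ⟩| ≤ δA := fun z hz => hreg z (hsub hz)
  -- block-union facts at every level `l ≤ k`
  have hΩl : ∀ {l : ℕ}, l ≤ k → ∀ x x' : HiggsLattice.Site P 0, blockIter l x = blockIter l x' → (x ∈ Ω ↔ x' ∈ Ω) :=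
    fun hl => blockUnion_of_isBigBlockUnion hl hΩ
  have hΩ₂l : ∀ {l : ℕ}, l ≤ k → ∀ x x' : HiggsLattice.Site P 0, blockIter l x = blockIter l x' → (x ∈ Ω₂ ↔ x' ∈ Ω₂) :=
    fun hl => blockUnion_of_isBigBlockUnion hl hΩ₂
  -- (I.2.25), derivative member, on a region `R ∈ {Ω, Ω₂}` at a bond interior for `R`, rate `ρ`
  have hDl : ∀ (R : Finset (HiggsLattice.Site P 0)), IsBigBlockUnion k K₀ R → R ⊆ Ω → ∀ {l : ℕ}, 1 ≤ l → l ≤ k →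
      ∀ {b : HiggsLattice.PBond P 0}, Interior k K₀ R b.src →
      ∀ (g : ScalarField P 0 N) (M D : ℝ), (∀ y, ‖g y‖ ≤ M) → 0 ≤ D →
        (∀ z, g z ≠ 0 → D ≤ (HiggsLattice.Site.tdist b.src z : ℝ)) →
          ‖covDeriv C A (propagatorK C R A msq a l g) b‖ ≤ c₀' * P.mesh l * Real.exp (-(ρ * (D / (P.L : ℝ) ^ l))) * M := by
    intro R hR hRΩ l hl1 hlk b hb g M D hg hD0 hsupp
    have hRl : ∀ x x' : HiggsLattice.Site P 0, blockIter l x = blockIter l x' → (x ∈ R ↔ x' ∈ R) :=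
      blockUnion_of_isBigBlockUnion hlk hR
    have hregR : ∀ z ∈ R, ∀ μ ν : Fin P.d, |A ⟨z.shift ν, μ⟩ - A ⟨z, μ⟩| ≤ δA := fun z hz => hreg z (hRΩ hz)
    have hmesh_l : P.mesh l ≤ 1 := (mesh_mono P hlk).trans hmesh
    have h3l : ∀ μ, 3 * half P l K₀ ≤ P.sitesPerDir 0 μ := fun μ => (Nat.mul_le_mul_left _ (half_mono hlk)).trans (h3 μ)
    have hak : 0 ≤ B1.aSeq a P.L l := (B1.aSeq_pos ha hLr hl1).le
    have h := hD P rfl rfl hK₀M hl1 (hlk.trans hkK) h3l hmesh_l R (isBigBlockUnion_of_le hlk hR) A he₂ le_rfl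
      (reg223R_of_small C R A hlk hmesh_l he₂ hδA hregR hte₂ le_rfl) b.src b.dir (hb.margin' hlk) g M D hg hD0 hsupp
    have hcut : ∀ y ∈ R, propagatorK C R A msq a l (chi R • g) y = propagatorK C R A msq a l g y :=
      fun y hy => (propagatorK_apply_eq_chi C A hmsq hak hRl g hy).symm
    have hbb : (⟨b.src, b.dir⟩ : HiggsLattice.PBond P 0) = b := rfl
    rw [hbb] at h
    have hb' : covDeriv C A (propagatorK C R A msq a l (chi R • g)) b = covDeriv C A (propagatorK C R A msq a l g) b := by
      have h1 : propagatorK C R A msq a l (chi R • g) b.tgt = propagatorK C R A msq a l g b.tgt := hcut _ (hb.shift_mem b.dir)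
      have h2 : propagatorK C R A msq a l (chi R • g) b.src = propagatorK C R A msq a l g b.src := hcut _ hb.mem
      rw [B1Cor23RegularRegion.covDeriv_eq, B1Cor23RegularRegion.covDeriv_eq, h1, h2]
    rw [hb'] at h
    refine h.trans ?_
    have hM : 0 ≤ M := (norm_nonneg _).trans (hg b.src)
    have hLl : (0 : ℝ) < (P.L : ℝ) ^ l := pow_pos (by exact_mod_cast P.hL) l
    have hexp := exp_kappa_le (κ := 4 * (K₀ : ℝ)) (by positivity) hρ4 hD0 hLl
    exact mul_le_mul_of_nonneg_right (mul_le_mul_of_nonneg_left hexp (mul_nonneg hc₀'.le (P.mesh_pos l).le)) hM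
  -- (I.2.26), derivative member, for `Ω₂ ⊆ Ω` at a bond interior for `Ω₂`, rate `ρ`, with the smallness `e^{−ρ·dist(b₋,Ω₂ᶜ)/L^l}`
  have hΔl : ∀ {l : ℕ}, 1 ≤ l → l ≤ k → ∀ {b : HiggsLattice.PBond P 0}, Interior k K₀ Ω₂ b.src →
      ∀ (g : ScalarField P 0 N) (M D : ℝ), (∀ y, ‖g y‖ ≤ M) → 0 ≤ D →
        (∀ z, g z ≠ 0 → D ≤ (HiggsLattice.Site.tdist b.src z : ℝ)) →
          ‖covDeriv C A ((propagatorK C Ω A msq a l - propagatorK C Ω₂ A msq a l) g) b‖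
            ≤ (c₀'' * P.mesh l * Real.exp (-(ρ * (distC Ω₂ b.src / (P.L : ℝ) ^ l)))) *
                Real.exp (-(ρ * (D / (P.L : ℝ) ^ l))) * M := by
    intro l hl1 hlk b hb g M D hg hD0 hsupp
    have hmesh_l : P.mesh l ≤ 1 := (mesh_mono P hlk).trans hmesh
    have h3l : ∀ μ, 3 * half P l K₀ ≤ P.sitesPerDir 0 μ := fun μ => (Nat.mul_le_mul_left _ (half_mono hlk)).trans (h3 μ)
    have hak : 0 ≤ B1.aSeq a P.L l := (B1.aSeq_pos ha hLr hl1).le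
    have h := (hΔ P rfl rfl hK₀M hl1 (hlk.trans hkK) h3l hmesh_l Ω₂ Ω (isBigBlockUnion_of_le hlk hΩ₂)
      (isBigBlockUnion_of_le hlk hΩ) hsub A he₃ le_rfl (reg223R_of_small C Ω A hlk hmesh_l he₃ hδA hreg hte₃ le_rfl) b.src
      (hb.margin' hlk) g M D (distC Ω₂ b.src) 0 hg hD0 (distC_nonneg _ _) le_rfl hsupp
      (fun z hz => distC_le Ω₂ b.src hz) (fun y z _ _ => Nat.cast_nonneg _)).2 b.dir
    have hcut : ∀ y ∈ Ω, propagatorK C Ω A msq a l (chi Ω • g) y = propagatorK C Ω A msq a l g y :=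
      fun y hy => (propagatorK_apply_eq_chi C A hmsq hak (hΩl hlk) g hy).symm
    have hcut₂ : ∀ y ∈ Ω₂, propagatorK C Ω₂ A msq a l (chi Ω₂ • g) y = propagatorK C Ω₂ A msq a l g y :=
      fun y hy => (propagatorK_apply_eq_chi C A hmsq hak (hΩ₂l hlk) g hy).symm
    have hbb : (⟨b.src, b.dir⟩ : HiggsLattice.PBond P 0) = b := rfl
    rw [hbb] at h
    have hb' : covDeriv C A (propagatorK C Ω₂ A msq a l (chi Ω₂ • g) - propagatorK C Ω A msq a l (chi Ω • g)) b
        = covDeriv C A (propagatorK C Ω₂ A msq a l g - propagatorK C Ω A msq a l g) b := by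
      have h1 : (propagatorK C Ω₂ A msq a l (chi Ω₂ • g) - propagatorK C Ω A msq a l (chi Ω • g)) b.tgt
          = (propagatorK C Ω₂ A msq a l g - propagatorK C Ω A msq a l g) b.tgt := by
        rw [Pi.sub_apply, Pi.sub_apply, hcut₂ b.tgt (hb.shift_mem b.dir), hcut b.tgt (hsub (hb.shift_mem b.dir))]
      have h2 : (propagatorK C Ω₂ A msq a l (chi Ω₂ • g) - propagatorK C Ω A msq a l (chi Ω • g)) b.src
          = (propagatorK C Ω₂ A msq a l g - propagatorK C Ω A msq a l g) b.src := by
        rw [Pi.sub_apply, Pi.sub_apply, hcut₂ b.src hb.mem, hcut b.src (hsub hb.mem)]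
      rw [B1Cor23RegularRegion.covDeriv_eq, B1Cor23RegularRegion.covDeriv_eq, h1, h2]
    rw [hb'] at h
    have hsgn : ‖covDeriv C A ((propagatorK C Ω A msq a l - propagatorK C Ω₂ A msq a l) g) b‖
        = ‖covDeriv C A (propagatorK C Ω₂ A msq a l g - propagatorK C Ω A msq a l g) b‖ := by
      rw [LinearMap.sub_apply, covDeriv_sub', covDeriv_sub', norm_sub_rev]
    rw [hsgn]
    refine h.trans ?_
    have hLl : (0 : ℝ) < (P.L : ℝ) ^ l := pow_pos (by exact_mod_cast P.hL) l
    have hM : 0 ≤ M := (norm_nonneg _).trans (hg b.src)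
    have hexp : Real.exp (-((D + distC Ω₂ b.src + 0) / (8 * K₀ * (P.L : ℝ) ^ l)))
        ≤ Real.exp (-(ρ * (distC Ω₂ b.src / (P.L : ℝ) ^ l))) * Real.exp (-(ρ * (D / (P.L : ℝ) ^ l))) := by
      rw [add_zero, ← Real.exp_add]
      have h1 := exp_kappa_le (κ := 8 * (K₀ : ℝ)) (by positivity) hρ8 (add_nonneg hD0 (distC_nonneg Ω₂ b.src)) hLl
      refine h1.trans (le_of_eq ?_)
      congr 1
      rw [add_div]
      ring
    calc c₀'' * P.mesh l * Real.exp (-((D + distC Ω₂ b.src + 0) / (8 * K₀ * (P.L : ℝ) ^ l))) * M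
        ≤ c₀'' * P.mesh l * (Real.exp (-(ρ * (distC Ω₂ b.src / (P.L : ℝ) ^ l))) *
            Real.exp (-(ρ * (D / (P.L : ℝ) ^ l)))) * M :=
          mul_le_mul_of_nonneg_right (mul_le_mul_of_nonneg_left hexp (mul_nonneg hc₀''.le (P.mesh_pos l).le)) hM
      _ = _ := by ring
  -- (I.2.34) on `Ω^{(l)} × Ω^{(l)}` (p35, first member), rate `ρ`
  have hCl : ∀ {l : ℕ}, 1 ≤ l → l < k → ∀ s t : HiggsLattice.Site P l × Ix N, s.1 ∈ levelSet l Ω → t.1 ∈ levelSet l Ω →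
      |mat (fluctCovA C Ω A msq a l) s t| ≤ c₁ * P.mesh l ^ 2 * Real.exp (-(ρ * (HiggsLattice.Site.tdist s.1 t.1 : ℝ))) := by
    intro l hl1 hlk s t hs ht'
    obtain ⟨j, rfl⟩ : ∃ j, l = j + 1 := ⟨l - 1, by omega⟩
    have hmesh_l : P.mesh (j + 1) ≤ 1 := (mesh_mono P hlk.le).trans hmesh
    have hjK : j + 1 < P.K := lt_of_lt_of_le hlk hkK
    have htl : (P.L : ℝ) ^ (j + 1) * δA * |C.e| ≤ t₀ := by
      have hpow : (P.L : ℝ) ^ (j + 1) ≤ (P.L : ℝ) ^ k := pow_le_pow_right₀ hLge1 hlk.le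
      have h0 : 0 ≤ δA * |C.e| := by positivity
      calc (P.L : ℝ) ^ (j + 1) * δA * |C.e| = (P.L : ℝ) ^ (j + 1) * (δA * |C.e|) := by ring
        _ ≤ (P.L : ℝ) ^ k * (δA * |C.e|) := mul_le_mul_of_nonneg_right hpow h0
        _ = (P.L : ℝ) ^ k * δA * |C.e| := by ring
        _ ≤ t₀ := htt₀
    have hjk : j < k := by omega
    have hpf : pieceF (towerR Ω k) ⟨j, hjk⟩ = Ω := pieceF_towerR ⟨j, hjk⟩ (hΩl hlk.le)
    have hregF : ∀ z ∈ pieceF (towerR Ω k) ⟨j, hjk⟩, ∀ μ' ν : Fin P.d, |A ⟨z.shift ν, μ'⟩ - A ⟨z, μ'⟩| ≤ δA := by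
      rw [hpf]; exact hreg
    have hj2 : j + 2 ≤ k := by omega
    have hΛ := levelSet_blockUnion hjK.le (hΩl hlk.le) (hΩl hj2)
    have h := (hCov C P rfl rfl (towerR Ω k) hkK ⟨j, hjk⟩ hjK hmesh_l hΛ A hδA hregF htl (Λ := levelSet (j + 1) Ω)
      (subset_refl _) hs ht').1
    rw [hpf, mat_condCov232_levelSet C A hjK.le hmsq ha hLr (hΩl hlk.le) (hΩl hj2) hs] at h
    refine h.trans ?_
    have hexp : Real.exp (-(ρ₃ * (HiggsLattice.Site.tdist s.1 t.1 : ℝ))) ≤ Real.exp (-(ρ * (HiggsLattice.Site.tdist s.1 t.1 : ℝ))) :=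
      exp_rate_mono' hρ₃' (Nat.cast_nonneg _)
    calc P.mesh (j + 1) ^ 2 * c₁ * Real.exp (-(ρ₃ * (HiggsLattice.Site.tdist s.1 t.1 : ℝ)))
        ≤ P.mesh (j + 1) ^ 2 * c₁ * Real.exp (-(ρ * (HiggsLattice.Site.tdist s.1 t.1 : ℝ))) :=
          mul_le_mul_of_nonneg_left hexp (by positivity)
      _ = _ := by ring
  -- `δC = C^{(l)}(Ω) − C^{(l)}(Ω₂)` on `Ω₂^{(l)} × Ω₂^{(l)}`: conditioning correction (I.2.35) plus (I.2.38), rate `ρ`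
  have hdCl : ∀ {l : ℕ}, 1 ≤ l → l < k → ∀ s t : HiggsLattice.Site P l × Ix N, s.1 ∈ levelSet l Ω₂ → t.1 ∈ levelSet l Ω₂ →
      |mat (fluctCovA C Ω A msq a l - fluctCovA C Ω₂ A msq a l) s t|
        ≤ (c₁ + c₄) * P.mesh l ^ 2 * Real.exp (-(ρ * ((HiggsLattice.Site.tdist s.1 t.1 : ℝ) +
            distC (levelSet l Ω₂) s.1 + distC (levelSet l Ω₂) t.1))) := by
    intro l hl1 hlk s t hs₂ ht₂
    obtain ⟨j, rfl⟩ : ∃ j, l = j + 1 := ⟨l - 1, by omega⟩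
    have hmesh_l : P.mesh (j + 1) ≤ 1 := (mesh_mono P hlk.le).trans hmesh
    have hjK : j + 1 < P.K := lt_of_lt_of_le hlk hkK
    have hpow : (P.L : ℝ) ^ (j + 1) ≤ (P.L : ℝ) ^ k := pow_le_pow_right₀ hLge1 hlk.le
    have htl : (P.L : ℝ) ^ (j + 1) * δA * |C.e| ≤ t₀ := by
      have h0 : 0 ≤ δA * |C.e| := by positivity
      calc (P.L : ℝ) ^ (j + 1) * δA * |C.e| = (P.L : ℝ) ^ (j + 1) * (δA * |C.e|) := by ring
        _ ≤ (P.L : ℝ) ^ k * (δA * |C.e|) := mul_le_mul_of_nonneg_right hpow h0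
        _ = (P.L : ℝ) ^ k * δA * |C.e| := by ring
        _ ≤ t₀ := htt₀
    have hcl : (P.L : ℝ) ^ (j + 1) * δA ≤ c * |C.e| := (mul_le_mul_of_nonneg_right hpow hδA).trans hc'
    have hjk : j < k := by omega
    have hj2 : j + 2 ≤ k := by omega
    have hs : s.1 ∈ levelSet (j + 1) Ω := levelSet_mono hsub hs₂
    have hpf : pieceF (towerR Ω k) ⟨j, hjk⟩ = Ω := pieceF_towerR ⟨j, hjk⟩ (hΩl hlk.le)
    have hpf₂ : pieceF (towerR Ω₂ k) ⟨j, hjk⟩ = Ω₂ := pieceF_towerR ⟨j, hjk⟩ (hΩ₂l hlk.le)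
    have hblk : (towerR Ω k).block ⟨j, hjk⟩ = levelSet (j + 1) Ω := rfl
    have hblk₂ : (towerR Ω₂ k).block ⟨j, hjk⟩ = levelSet (j + 1) Ω₂ := rfl
    have hregF : ∀ z ∈ pieceF (towerR Ω k) ⟨j, hjk⟩, ∀ μ' ν : Fin P.d, |A ⟨z.shift ν, μ'⟩ - A ⟨z, μ'⟩| ≤ δA := by
      rw [hpf]; exact hreg
    have hΛ := levelSet_blockUnion hjK.le (hΩl hlk.le) (hΩl hj2)
    have hΛ₂ := levelSet_blockUnion hjK.le (hΩ₂l hlk.le) (hΩ₂l hj2)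
    -- (I.2.35): conditioning `C^{(l)}(Ω)` on `Ω₂^{(l)} ⊆ Ω^{(l)}`
    have hA := (hCov C P rfl rfl (towerR Ω k) hkK ⟨j, hjk⟩ hjK hmesh_l hΛ A hδA hregF htl (Λ := levelSet (j + 1) Ω₂)
      (levelSet_mono hsub) hs₂ ht₂).2
    rw [hpf, hblk] at hA
    -- (I.2.38): the two regions, conditioned on `Ω₂^{(l)}`
    have hB := h238 C hCe P rfl rfl (towerR Ω₂ k) (towerR Ω k) hkK ⟨j, hjk⟩ hjK hmesh_l hΛ₂ hΛ (levelSet_mono hsub) A hδA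
      hregF hcl (Λ := levelSet (j + 1) Ω₂) (subset_refl _) hs₂ ht₂
    rw [hpf, hpf₂, hblk₂] at hB
    rw [mat_sub, ← mat_condCov232_levelSet C A hjK.le hmsq ha hLr (hΩl hlk.le) (hΩl hj2) hs,
      ← mat_condCov232_levelSet C A hjK.le hmsq ha hLr (hΩ₂l hlk.le) (hΩ₂l hj2) hs₂]
    set X := mat (condCov232 C Ω A msq a (j + 1) (levelSet (j + 1) Ω)) s t with hX
    set Y := mat (condCov232 C Ω A msq a (j + 1) (levelSet (j + 1) Ω₂)) s t with hY
    set Z := mat (condCov232 C Ω₂ A msq a (j + 1) (levelSet (j + 1) Ω₂)) s t with hZ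
    set S := (HiggsLattice.Site.tdist s.1 t.1 : ℝ) + distC (levelSet (j + 1) Ω₂) s.1 + distC (levelSet (j + 1) Ω₂) t.1 with hS
    have hS0 : 0 ≤ S := by rw [hS]; exact add_nonneg (add_nonneg (Nat.cast_nonneg _) (distC_nonneg _ _)) (distC_nonneg _ _)
    have htri : |X - Z| ≤ |Y - X| + |Z - Y| := by
      calc |X - Z| = |(X - Y) + (Y - Z)| := by ring_nf
        _ ≤ |X - Y| + |Y - Z| := abs_add_le _ _
        _ = |Y - X| + |Z - Y| := by rw [abs_sub_comm X Y, abs_sub_comm Y Z]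
    have hA' : |Y - X| ≤ P.mesh (j + 1) ^ 2 * c₁ * Real.exp (-(ρ * S)) :=
      hA.trans (mul_le_mul_of_nonneg_left (exp_rate_mono' hρ₃' hS0) (by positivity))
    have hB' : |Z - Y| ≤ P.mesh (j + 1) ^ 2 * c₄ * Real.exp (-(ρ * S)) :=
      hB.trans (mul_le_mul_of_nonneg_left (exp_rate_mono' hρ₄' hS0) (by positivity))
    calc |X - Z| ≤ |Y - X| + |Z - Y| := htri
      _ ≤ P.mesh (j + 1) ^ 2 * c₁ * Real.exp (-(ρ * S)) + P.mesh (j + 1) ^ 2 * c₄ * Real.exp (-(ρ * S)) := add_le_add hA' hB'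
      _ = _ := by ring
  -- geometry of the two points
  have hxΩ : Interior k K₀ Ω x := Interior.mono hsub hx
  have hx'Ω : Interior k K₀ Ω x' := Interior.mono hsub hx'
  have hD₀0 : 0 ≤ distC Ω₂ x := distC_nonneg _ _
  have hD₀'0 : 0 ≤ distC Ω₂ x' := distC_nonneg _ _
  have hT0 : 0 ≤ (HiggsLattice.Site.tdist x x' : ℝ) := Nat.cast_nonneg _
  have htri₁ : distC Ω₂ x' ≤ (HiggsLattice.Site.tdist x x' : ℝ) + distC Ω₂ x := by
    rw [tdist_comm]; exact distC_le_tdist_add Ω₂ x' x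
  have htri₂ : distC Ω₂ x ≤ (HiggsLattice.Site.tdist x x' : ℝ) + distC Ω₂ x' := distC_le_tdist_add Ω₂ x x'
  set S₀ := (HiggsLattice.Site.tdist x x' : ℝ) + distC Ω₂ x + distC Ω₂ x' with hS₀
  have hS₀0 : 0 ≤ S₀ := add_nonneg (add_nonneg hT0 hD₀0) hD₀'0
  have hmj : 0 < P.mesh j := P.mesh_pos j
  have hLj : (0 : ℝ) < (P.L : ℝ) ^ j := pow_pos (by exact_mod_cast P.hL) j
  -- the final rate `ρ/(8L)` is dominated by `ρ/8` per `L^j` and by `ρ/2` per `L` at `j = 0`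
  have hfin : ∀ {r : ℝ}, ρ / 8 ≤ r → Real.exp (-(r * (S₀ / (P.L : ℝ) ^ j))) ≤ Real.exp (-(ρ / (8 * P.L) * (S₀ / (P.L : ℝ) ^ j))) := by
    intro r hr
    refine exp_rate_mono' (le_trans ?_ hr) (div_nonneg hS₀0 hLj.le)
    rw [div_le_div_iff₀ (by positivity) (by norm_num : (0:ℝ) < 8)]
    nlinarith
  rcases Nat.eq_zero_or_pos j with rfl | hj1
  · -- `j = 0`: (I.2.26) at level `1` on the dipole source
    have h0 := mixedDelta_piece_zero_le C Ω Ω₂ A msq (k := k) (a := a)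
      (cδ := c₀'' * Real.exp (-(ρ * (distC Ω₂ x / (P.L : ℝ) ^ 1)))) (ρ := ρ) (by positivity) hρpos.le (x := x) (μ := μ)
      (fun g M D hg hD0 hsupp => (hΔl le_rfl hk1 (b := ⟨x, μ⟩) hx g M D hg hD0 hsupp).trans (le_of_eq (by ring))) ν x'
    refine h0.trans ?_
    rw [pow_one] at h0 ⊢
    rw [pow_zero, div_one]
    -- smallness × decay ≤ three-distance form
    have h82 : ρ / (8 * P.L) ≤ ρ / (2 * P.L) := by
      rw [div_le_div_iff₀ (by positivity) (by positivity)]; nlinarith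
    have hsq : Real.exp (-(ρ * (distC Ω₂ x / P.L))) * Real.exp (-(ρ * ((HiggsLattice.Site.tdist x x' : ℝ) / P.L)))
        ≤ Real.exp (-(ρ / (8 * P.L) * S₀)) := by
      refine (exp_squeeze hρpos.le hLpos htri₁).trans ?_
      rw [← hS₀]
      apply Real.exp_le_exp.mpr
      have h1 : ρ / 2 * (S₀ / P.L) = ρ / (2 * P.L) * S₀ := by ring
      rw [h1]
      linarith [mul_le_mul_of_nonneg_right h82 hS₀0]
    have hCz' : (N : ℝ) * 2 * (c₀'' * Real.exp (-(ρ * (distC Ω₂ x / P.L)))) * (P.L : ℝ) * Real.exp ρ * (P.mesh 0 ^ P.d)⁻¹ *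
        Real.exp (-(ρ * ((HiggsLattice.Site.tdist x x' : ℝ) / P.L)))
        = Cz * (P.mesh 0 ^ P.d)⁻¹ * (Real.exp (-(ρ * (distC Ω₂ x / P.L))) *
            Real.exp (-(ρ * ((HiggsLattice.Site.tdist x x' : ℝ) / P.L)))) := by rw [hCz]; ring
    rw [hCz']
    have hm0 : 0 ≤ (P.mesh 0 ^ P.d)⁻¹ := inv_nonneg.mpr (pow_nonneg (P.mesh_pos 0).le _)
    calc Cz * (P.mesh 0 ^ P.d)⁻¹ * (Real.exp (-(ρ * (distC Ω₂ x / P.L))) *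
          Real.exp (-(ρ * ((HiggsLattice.Site.tdist x x' : ℝ) / P.L))))
        ≤ Cz * (P.mesh 0 ^ P.d)⁻¹ * Real.exp (-(ρ / (8 * P.L) * S₀)) := mul_le_mul_of_nonneg_left hsq (mul_nonneg hCz0 hm0)
      _ ≤ (1 + Cz + Cp) * (P.mesh 0 ^ P.d)⁻¹ * Real.exp (-(ρ / (8 * P.L) * S₀)) := by
          gcongr; linarith
  · by_cases hjk : j < k
    · have hjK : j ≤ P.K := hjk.le.trans hkK
      -- the smallness factors at the two bonds
      set θb := Real.exp (-(ρ * (distC Ω₂ x / (P.L : ℝ) ^ j))) with hθb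
      set θc := Real.exp (-(ρ * (distC Ω₂ x' / (P.L : ℝ) ^ j))) with hθc
      set Θb := Real.exp (-(ρ / 2 * distC (levelSet j Ω₂) (blockIter j x))) with hΘb
      set Θc := Real.exp (-(ρ / 2 * distC (levelSet j Ω₂) (blockIter j x'))) with hΘc
      have hσ : (0 : ℝ) ≤ ρ / 2 := by linarith
      -- the seven kernel bounds at `b = ⟨x,μ⟩`, `c = ⟨x′,ν⟩`
      have hpos := mixedDelta_piece_pos_le C Ω Ω₂ A msq (k := k) ha hL1' hj1 hjk hjK hmsq hsub (hΩl hjk.le) (hΩ₂l hjk.le)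
        (x := x) (x' := x') (μ := μ) (ν := ν) hx.mem (hx.shift_mem μ) hx'.mem (hx'.shift_mem ν)
        (cδb := c₀'' * Ecb * θb) (cΩ := c₀' * Ecb) (c₂ := c₀' * Ecb) (cδc := c₀'' * Ecb * θc) (c₂' := c₀' * Ecb) (β := c₁)
        (β' := (c₁ + c₄) * Θb * Θc) (ρ := ρ) (σ := ρ / 2) (by positivity) (by positivity) (by positivity) (by positivity)
        (by positivity) hc₁.le (by positivity) hρpos hσ (by linarith)
        (fun s _ => (norm_covDeriv_F_avgQkAdj_cb_le C A hjK (propagatorK C Ω A msq a j - propagatorK C Ω₂ A msq a j)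
          (cF := c₀'' * P.mesh j * θb) (by positivity) hρpos.le (b := ⟨x, μ⟩)
          (fun g M D hg hD0 hsupp => hΔl hj1 hjk.le (b := ⟨x, μ⟩) hx g M D hg hD0 hsupp) s).trans (le_of_eq (by rw [hEcb]; ring)))
        (fun t _ => (norm_covDeriv_F_avgQkAdj_cb_le C A hjK (propagatorK C Ω A msq a j) (cF := c₀' * P.mesh j) (by positivity)
          hρpos.le (b := ⟨x', ν⟩) (fun g M D hg hD0 hsupp => hDl Ω hΩ subset_rfl hj1 hjk.le (b := ⟨x', ν⟩) hx'Ω g M D hg hD0 hsupp)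
          t).trans (le_of_eq (by rw [hEcb]; ring)))
        (fun s _ => (norm_covDeriv_F_avgQkAdj_cb_le C A hjK (propagatorK C Ω₂ A msq a j) (cF := c₀' * P.mesh j) (by positivity)
          hρpos.le (b := ⟨x, μ⟩) (fun g M D hg hD0 hsupp => hDl Ω₂ hΩ₂ hsub hj1 hjk.le (b := ⟨x, μ⟩) hx g M D hg hD0 hsupp)
          s).trans (le_of_eq (by rw [hEcb]; ring)))
        (fun t _ => (norm_covDeriv_F_avgQkAdj_cb_le C A hjK (propagatorK C Ω A msq a j - propagatorK C Ω₂ A msq a j)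
          (cF := c₀'' * P.mesh j * θc) (by positivity) hρpos.le (b := ⟨x', ν⟩)
          (fun g M D hg hD0 hsupp => hΔl hj1 hjk.le (b := ⟨x', ν⟩) hx' g M D hg hD0 hsupp) t).trans (le_of_eq (by rw [hEcb]; ring)))
        (fun t _ => (norm_covDeriv_F_avgQkAdj_cb_le C A hjK (propagatorK C Ω₂ A msq a j) (cF := c₀' * P.mesh j) (by positivity)
          hρpos.le (b := ⟨x', ν⟩) (fun g M D hg hD0 hsupp => hDl Ω₂ hΩ₂ hsub hj1 hjk.le (b := ⟨x', ν⟩) hx' g M D hg hD0 hsupp)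
          t).trans (le_of_eq (by rw [hEcb]; ring)))
        (hCl hj1 hjk)
        (fun s t hs ht => by
          refine (hdCl hj1 hjk s t hs ht).trans ?_
          rw [exp_sum3_eq]
          have e1 : Real.exp (-(ρ * distC (levelSet j Ω₂) s.1))
              ≤ Real.exp (ρ / 2 * (HiggsLattice.Site.tdist (blockIter j x) s.1 : ℝ)) * Θb :=
            (exp_rate_mono' (by linarith : ρ / 2 ≤ ρ) (distC_nonneg _ _)).trans
              (exp_distC_le_of_triangle (levelSet j Ω₂) hσ s.1 (blockIter j x))
          have e2 : Real.exp (-(ρ * distC (levelSet j Ω₂) t.1))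
              ≤ Real.exp (ρ / 2 * (HiggsLattice.Site.tdist (blockIter j x') t.1 : ℝ)) * Θc :=
            (exp_rate_mono' (by linarith : ρ / 2 ≤ ρ) (distC_nonneg _ _)).trans
              (exp_distC_le_of_triangle (levelSet j Ω₂) hσ t.1 (blockIter j x'))
          have hΘb0 : 0 ≤ Θb := (Real.exp_pos _).le
          have hΘc0 : 0 ≤ Θc := (Real.exp_pos _).le
          calc (c₁ + c₄) * P.mesh j ^ 2 * (Real.exp (-(ρ * (HiggsLattice.Site.tdist s.1 t.1 : ℝ))) *
                Real.exp (-(ρ * distC (levelSet j Ω₂) s.1)) * Real.exp (-(ρ * distC (levelSet j Ω₂) t.1)))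
              ≤ (c₁ + c₄) * P.mesh j ^ 2 * (Real.exp (-(ρ * (HiggsLattice.Site.tdist s.1 t.1 : ℝ))) *
                (Real.exp (ρ / 2 * (HiggsLattice.Site.tdist (blockIter j x) s.1 : ℝ)) * Θb) *
                (Real.exp (ρ / 2 * (HiggsLattice.Site.tdist (blockIter j x') t.1 : ℝ)) * Θc)) := by
                gcongr
            _ = _ := by ring)
      refine hpos.trans ?_
      -- `profile` after `subst`: the tree's lattice constant of `P.d`
      have hKp' : profile P N ((ρ - ρ / 2) / 2) ^ 2 * Real.exp ((ρ - ρ / 2) / 2) = Kp := by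
        rw [hKp, show (ρ - ρ / 2) / 2 = ρ / 4 by ring]
      rw [hKp']
      have hr4 : (ρ - ρ / 2) / 2 = ρ / 4 := by ring
      rw [hr4]
      set E := Real.exp (-(ρ / 4 * ((HiggsLattice.Site.tdist x x' : ℝ) / (P.L : ℝ) ^ j))) with hE
      set F := Real.exp (-(ρ / (8 * P.L) * (S₀ / (P.L : ℝ) ^ j))) with hF
      -- the three smallness factors against the decay factor
      have h4ρ : ρ / 4 ≤ ρ := by linarith
      have hθbE : θb * E ≤ F := by
        have h1 : θb ≤ Real.exp (-(ρ / 4 * (distC Ω₂ x / (P.L : ℝ) ^ j))) := exp_rate_mono' h4ρ (div_nonneg hD₀0 hLj.le)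
        refine (mul_le_mul_of_nonneg_right h1 (Real.exp_pos _).le).trans ?_
        refine (exp_squeeze (by positivity) hLj htri₁).trans ?_
        rw [← hS₀, show ρ / 4 / 2 = ρ / 8 by ring]
        exact hfin le_rfl
      have hθcE : θc * E ≤ F := by
        have h1 : θc ≤ Real.exp (-(ρ / 4 * (distC Ω₂ x' / (P.L : ℝ) ^ j))) := exp_rate_mono' h4ρ (div_nonneg hD₀'0 hLj.le)
        refine (mul_le_mul_of_nonneg_right h1 (Real.exp_pos _).le).trans ?_
        have hsq := exp_squeeze (r := ρ / 4) (T := (HiggsLattice.Site.tdist x x' : ℝ)) (by positivity) hLj htri₂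
        refine hsq.trans ?_
        rw [show (HiggsLattice.Site.tdist x x' : ℝ) + distC Ω₂ x' + distC Ω₂ x = S₀ by rw [hS₀]; ring,
          show ρ / 4 / 2 = ρ / 8 by ring]
        exact hfin le_rfl
      have hΘE : Θb * Θc * E ≤ Real.exp (2 * (ρ / 2)) * F := by
        have h1 : Θb ≤ Real.exp (ρ / 2) * Real.exp (-(ρ / 2 * (distC Ω₂ x / (P.L : ℝ) ^ j))) :=
          exp_distC_block_le hjK (hΩ₂l hjk.le) hσ x
        have h2 : Θc ≤ Real.exp (ρ / 2) * Real.exp (-(ρ / 2 * (distC Ω₂ x' / (P.L : ℝ) ^ j))) :=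
          exp_distC_block_le hjK (hΩ₂l hjk.le) hσ x'
        have h3 : Real.exp (-(ρ / 2 * (distC Ω₂ x / (P.L : ℝ) ^ j))) * Real.exp (-(ρ / 2 * (distC Ω₂ x' / (P.L : ℝ) ^ j))) * E
            ≤ F := by
          rw [hE, ← Real.exp_add, ← Real.exp_add, hF]
          refine (Real.exp_le_exp.mpr ?_).trans (hfin (by linarith : ρ / 8 ≤ ρ / 4))
          rw [hS₀]
          have : ρ / 4 * (((HiggsLattice.Site.tdist x x' : ℝ) + distC Ω₂ x + distC Ω₂ x') / (P.L : ℝ) ^ j)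
              = ρ / 4 * ((HiggsLattice.Site.tdist x x' : ℝ) / (P.L : ℝ) ^ j) + ρ / 4 * (distC Ω₂ x / (P.L : ℝ) ^ j) +
                ρ / 4 * (distC Ω₂ x' / (P.L : ℝ) ^ j) := by ring
          rw [this]
          have ha1 : 0 ≤ distC Ω₂ x / (P.L : ℝ) ^ j := div_nonneg hD₀0 hLj.le
          have ha2 : 0 ≤ distC Ω₂ x' / (P.L : ℝ) ^ j := div_nonneg hD₀'0 hLj.le
          nlinarith
        calc Θb * Θc * E ≤ (Real.exp (ρ / 2) * Real.exp (-(ρ / 2 * (distC Ω₂ x / (P.L : ℝ) ^ j)))) *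
              (Real.exp (ρ / 2) * Real.exp (-(ρ / 2 * (distC Ω₂ x' / (P.L : ℝ) ^ j)))) * E := by
              gcongr
          _ = Real.exp (2 * (ρ / 2)) * (Real.exp (-(ρ / 2 * (distC Ω₂ x / (P.L : ℝ) ^ j))) *
              Real.exp (-(ρ / 2 * (distC Ω₂ x' / (P.L : ℝ) ^ j))) * E) := by
              rw [show (2 : ℝ) * (ρ / 2) = ρ / 2 + ρ / 2 by ring, Real.exp_add]; ring
          _ ≤ Real.exp (2 * (ρ / 2)) * F := mul_le_mul_of_nonneg_left h3 (Real.exp_pos _).le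
      -- assemble
      have hmjd : 0 ≤ (P.mesh j ^ P.d)⁻¹ := inv_nonneg.mpr (pow_nonneg hmj.le _)
      have hsum3 : (c₀'' * Ecb * θb * c₁ * (c₀' * Ecb) + c₀' * Ecb * c₁ * (c₀'' * Ecb * θc) +
          c₀' * Ecb * ((c₁ + c₄) * Θb * Θc) * (c₀' * Ecb)) * E
          ≤ (c₀'' * Ecb * c₁ * (c₀' * Ecb) + c₀' * Ecb * c₁ * (c₀'' * Ecb) +
              c₀' * Ecb * ((c₁ + c₄) * Real.exp (2 * (ρ / 2))) * (c₀' * Ecb)) * F := by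
        have e1 : c₀'' * Ecb * θb * c₁ * (c₀' * Ecb) * E = c₀'' * Ecb * c₁ * (c₀' * Ecb) * (θb * E) := by ring
        have e2 : c₀' * Ecb * c₁ * (c₀'' * Ecb * θc) * E = c₀' * Ecb * c₁ * (c₀'' * Ecb) * (θc * E) := by ring
        have e3 : c₀' * Ecb * ((c₁ + c₄) * Θb * Θc) * (c₀' * Ecb) * E = c₀' * Ecb * (c₁ + c₄) * (c₀' * Ecb) * (Θb * Θc * E) := by
          ring
        calc (c₀'' * Ecb * θb * c₁ * (c₀' * Ecb) + c₀' * Ecb * c₁ * (c₀'' * Ecb * θc) +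
              c₀' * Ecb * ((c₁ + c₄) * Θb * Θc) * (c₀' * Ecb)) * E
            = c₀'' * Ecb * c₁ * (c₀' * Ecb) * (θb * E) + c₀' * Ecb * c₁ * (c₀'' * Ecb) * (θc * E) +
                c₀' * Ecb * (c₁ + c₄) * (c₀' * Ecb) * (Θb * Θc * E) := by rw [add_mul, add_mul, e1, e2, e3]
          _ ≤ c₀'' * Ecb * c₁ * (c₀' * Ecb) * F + c₀' * Ecb * c₁ * (c₀'' * Ecb) * F +
                c₀' * Ecb * (c₁ + c₄) * (c₀' * Ecb) * (Real.exp (2 * (ρ / 2)) * F) := by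
              gcongr
          _ = _ := by ring
      calc (N : ℝ) * a ^ 2 * (c₀'' * Ecb * θb * c₁ * (c₀' * Ecb) + c₀' * Ecb * c₁ * (c₀'' * Ecb * θc) +
            c₀' * Ecb * ((c₁ + c₄) * Θb * Θc) * (c₀' * Ecb)) * Kp * (P.mesh j ^ P.d)⁻¹ * E
          = (N : ℝ) * a ^ 2 * Kp * (P.mesh j ^ P.d)⁻¹ * ((c₀'' * Ecb * θb * c₁ * (c₀' * Ecb) + c₀' * Ecb * c₁ * (c₀'' * Ecb * θc) +
            c₀' * Ecb * ((c₁ + c₄) * Θb * Θc) * (c₀' * Ecb)) * E) := by ring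
        _ ≤ (N : ℝ) * a ^ 2 * Kp * (P.mesh j ^ P.d)⁻¹ * ((c₀'' * Ecb * c₁ * (c₀' * Ecb) + c₀' * Ecb * c₁ * (c₀'' * Ecb) +
              c₀' * Ecb * ((c₁ + c₄) * Real.exp (2 * (ρ / 2))) * (c₀' * Ecb)) * F) :=
            mul_le_mul_of_nonneg_left hsum3 (by positivity)
        _ = Cp * (P.mesh j ^ P.d)⁻¹ * F := by rw [hCp]; ring
        _ ≤ (1 + Cz + Cp) * (P.mesh j ^ P.d)⁻¹ * F := by
            have hF0 : 0 ≤ F := (Real.exp_pos _).le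
            gcongr; linarith
    · rw [mixedDeltaTermR_eq_zero_of_le C Ω Ω₂ A msq hj1 (not_lt.mp hjk)]
      positivity

end MainD

end Literature.MathematicalPhysics.QuantumFieldTheory.Balaban1983to89.B3DeltaGkMixedRegularRegion

end
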